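import Literature.MathematicalPhysics.QuantumFieldTheory.Balaban1983to89.B15ShellGauge193Local
import Literature.MathematicalPhysics.QuantumFieldTheory.Balaban1983to89.B15Eq177ValueInvarianceCoDiv
import Literature.MathematicalPhysics.QuantumFieldTheory.Balaban1983to89.B15Prop1SliceTaylorCalculus

/-!
# `Balaban1983to89.B15Prop1DatumGaugeNormalisation` — [Balaban1989LargeFieldI] = «[IV]», p. 193 (the extension `Ṽ_k` of a regular
# `V_k` to `Λ` through the surface gauge) and p. 194, the sentence after (1.77): *«The function is invariant with respect to the group of
# all gauge transformations defined on Λ, hence it is natural to consider it on orbits of this group.»* — THE GAUGE NORMALISATION OF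
# THE EXTENDED DATUM: a `k`-lattice gauge transformation, EQUAL TO `1` ON `Λ^{(k)}`, after which print's extension `Ṽ_k` is
# bond-wise near `1` on a whole parallelepiped around `Λ^{(k)}`; and the exact transport of the gauge-fixed slice function along such gauges

statement-level skeleton of published theorems with citation tags; proofs where landed; nothing here is a claim about the Yang–Mills mass gap

[IV] = T. Bałaban, *Large field renormalization. I. The basic step of the 𝐑 operation*, Commun. Math. Phys. **122** (1989) 175–202
[Balaban1989LargeFieldI], p. 193 (the extension), (1.77) and Prop. 1 p. 194; [LF-II] = T. Bałaban, *Large field renormalization. II*,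
Commun. Math. Phys. **122** (1989) 355–392 [Balaban1989LargeFieldII], p. 359 (*«B′ satisfying the gauge condition B′↾_{G₀} = 0»*);
[B7] = [Balaban1985Averaging] (8)–(9), (12) p. 19 (gauge transformations, parallel transport, gauge invariance); the lattice
non-abelian Poincaré lemma of `T4AxialGaugeSmallField` [folklore].

WHY (cell `pub-ymgap`, HUMAN RULING D-0062 ∕ D-0149, width seat `pub-ymgap-dag-n12-w6` g1; node N12 = [B15]; piece (r3a) of the LOCATED-`hU` repair road
of the N12∕s1 lane, dag-n12-w5 g3 ∕ dag-n12-c g17, 2026-08-28).  The near-flat letter package (N) of the lane's endpoint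
`B15Prop1EndpointNearFlatLetters` asks, per base field `V_k` in the (1.74) guard, for a (2.12) minimiser `U₀` of the data generated by the
extended datum `Ṽ_k = extend (pts k Λ) (shellGauge V_k lo hi) V_k` which is bond-wise near `1` (globally in v1.1, near `Ω₁` in the planned
v1.2).  The minimiser realises the data, so wherever the data are read off `Ṽ_k` itself the letter needs `Ṽ_k` bond-wise near `1` — which
the guard (plaquettes only) does not give: print's `Ṽ_k` is `V_k` off `Λ^{(k)}` (any gauge) and a pure gauge on the bonds meeting `Λ^{(k)}`.
Print's remedy is the sentence of p. 194: (1.77) is constant on gauge orbits, so the datum may be normalised first.  THIS FILE supplies the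
two kernel facts behind that remedy, in the tree's currency:
(A) the NORMALISING GAUGE (§2, §4): for a configuration `W` on `T^{(j)}` equal to `1` on the bonds inside a parallelepiped `Λs` and
plaquette-small on a bigger non-wrapping parallelepiped `[LO, HI] ⊇ Λs`, there is a gauge transformation `u` with `u = 1` ON `Λs` and
`|W^u(b) − 1| ≤ (d·n + 1)(d − 1)·n·ε` on EVERY bond of `[LO, HI]` (the bonds meeting `Λs` included) — `u` is the corner axial gauge of
`T4AxialGaugeSmallField` off `Λs`, renormalised by its value at one point of `Λs`, and `1` on `Λs`; at the objects of Proposition 1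
(`W = Ṽ_k`, `B15ShellGauge193Local.dist1_plaqHol_extend_shellGauge_le` for the plaquettes of `Ṽ_k`) this is §4;
(B) the EXACT TRANSPORT of the gauge-fixed slice function (§3): for a gauge-invariant `f` and a gauge transformation `u` equal to `1` at the
SOURCE of every free bond of the slice, `sliceFn S T f (W^u) = sliceFn S T f W` as functions — so every differential statement about the
slice function (the lane's `h17` clause) is the same at `W` and at `W^u`; at the background of record this is unconditional
(`B15Eq177ValueInvarianceCoDiv.fun177std_bgMSCoPOfRecord_gaugeAct`).

LOCATED-T (honest scope of (B), read off the typed objects; nothing repaired here).  `freeBonds S T = bondsOf S ∖ T` with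
`bondsOf S = {b | b₋ ∈ S ∨ b₊ ∈ S}`: the free bonds of the slice include the bonds ARRIVING in `S = Λ^{(k)}` from outside unless the tree
`T` contains them.  With the lane's tree of record (`hTG0`: the direction-`0` bonds ending in `Λ^{(k)}`) the incoming bonds of the lower
faces in the directions `μ ≠ 0` are free, their sources lie on `∂⁺Λ^{(k)}`, and the datum there is print's pure gauge
`Ṽ_k(x − e_μ, x) = g(x − e_μ)⁻¹`, `g = shellGauge V_k lo hi` (§3 `extend_apply_of_incoming`), of size O(1) under any plaquette hypothesis.
A gauge `u` making `Ṽ_k^u` near `1` on such a bond has `u(x − e_μ)` within the near-flatness of `g(x − e_μ)`, hence is NOT central there: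
the hypothesis of (B) then fails, and the transport holds only up to the bond-wise rotation `Ad(u(b₋))` of the slice coordinates on the
incoming free bonds (norm and Hessian pairing are invariant under it, the curl sum of the lane's Federbush clause is not).  So (A) is
unconditional, (B) is exact for trees `T` containing every incoming bond (`§3 src_mem_of_mem_freeBonds_of_incoming_subset`), and for the
tree of record the lane either enlarges `T` or carries the rotation (the fine-level precedent is dag-n12-w2's
`Node00.WilsonActionSecondVariationGauge`).  Nothing of this is asserted beyond what is proved below.

CONTENTS (theorems only; no `def`, no `instance`, no `sorry`; any `GaugeGroup` in §1–§2 and §4, `SU(2)` where the slice lives).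
* §1 [folklore] private `dist1` bookkeeping: `dist1_inv_mul_comm`, `dist1_inv_mul_triangle`, the three conjugation patterns of §2, and
  ★ `dist1_wander_le` — if `W^a` is `η`-near-flat on the bonds of `[LO, HI]` and `W = 1` on the bonds inside `[lo, hi] ⊆ [LO, HI]`, then
  `dist1 (a(lo)⁻¹ a(x)) ≤ |x − lo|₁·η` for `x ∈ [lo, hi]` (induction on `|x − lo|₁`).
* §2 ★★ `exists_gauge_one_on_box_nearFlat` — (A) on `T^{(j)}`.
* §3 `extend_apply_of_incoming` (print's pure gauge on an incoming bond), `mem_freeBonds_of_incoming`, `src_mem_of_mem_freeBonds_of_incoming_subset`;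
  ★ `expMul_gaugeAct_of_src` (`exp(i·ιA Y)·W^u = (exp(i·ιA Y)·W)^u` when `u = 1` at the sources of the free bonds, any chart with `exp 0 = 1`),
  ★★ `sliceFn_gaugeAct_of_src` ((B)), ★★ `sliceFn_fun177std_bgMSCoPOfRecord_gaugeAct_of_src` ((B) at the background of record, every `SU(2)` instance).
* §4 ★★★ `exists_gauge_normalising_extend` — (A) at the objects of Proposition 1: `Λ^{(k)} = castSite '' [lo, hi]` (`hbox`), the guard
  `PlaqSmallOn (plaqsInside (pts k (Z ∩ Λᶜ))) ε V_k`, `d ≥ 3`, a region parallelepiped `[LO, HI] ⊇ [lo, hi]` whose plaquettes lie in `Z^{(k)}`: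
  ∃ `u`, `u = 1` on `Λ^{(k)}` and `|Ṽ_k^u(b) − 1| ≤ (d·n′ + 1)(d − 1)n′·(12d(n + 2)² + 1)·ε` on every bond of `[LO, HI]`; `dist1_eq_norm_sub_one_su2`
  reads it in the lane's matrix norm.
* §5 `pull_gaugeAct`, `shellFn_gaugeAct`, `shellGauge_gaugeAct_castSite` (the shell gauge of p. 193 is gauge covariant: `g_{V^u}(s) = u(c₀)g_V(s)u(s)⁻¹`
  on the big box, `c₀ = castSite (lo − 1)`) and ★★ `extend_gaugeAct_of_eq_one` — THE EXTENSION COMMUTES with every gauge `u` equal to `1` on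
  `Λ^{(k)}` and at the corner `c₀`: `Ṽ(V^u) = Ṽ(V)^u`; so p. 194's orbit remark may be applied to `V_k` itself (the (1.74) guard is gauge
  invariant), the extended datum following by the same `u`.

HONEST FRAMING: count-neutral kernel bookkeeping on Bałaban AS PRINTED (p. 193's extension, p. 194's invariance sentence, the folklore
Poincaré lemma); nothing of [15] Thm 1 ∕ Proposition 1 is asserted; N12 NOT discharged; finite 𝕋⁴ at fixed ε; nothing continuum ∕ OS ∕
mass-gap ∕ Clay.
-/

noncomputable section

open Set
open scoped Matrix.Norms.L2Operator

namespace Literature.MathematicalPhysics.QuantumFieldTheory.Balaban1983to89.B15Prop1DatumGaugeNormalisation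

open GaugeField B15DeterminingSets B15Prop1Carrier B16Sect1Backgrounds B15Sect1Instances Node00 T4Continuum
open T4AxialGaugeSmallField (castSite castSite_add_e boxPlaqs boxBonds axialGauge dist1_gaugeAct_axialGauge_le_uniform)
open B7Prop1Explicit (e e_apply)
open B15Extension193 (extend extend_of_mem_of_mem extend_of_touches cutoff_of_mem cutoff_of_not_mem Touches)
open B15ShellGauge193 (shellGauge)
open B15ShellGauge193Local (dist1_plaqHol_extend_shellGauge_le)
open B15Prop1SliceCoordinates (GaugeSlice ιA freeBonds mem_freeBonds ιA_apply_of_mem ιA_apply_of_not_mem)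
open B15Prop1SliceTaylorCalculus (sliceFn sliceFn_apply)
open B15Prop1ChartCalculusSU2 (E3)
open B15Prop1ChartSU2 (su2Chart)
open T4CubeChartGnomonic (SU2)
open B15Eq177ValueInvarianceCoDiv (fun177std_bgMSCoPOfRecord_gaugeAct)

/-! ## §1  `dist1` bookkeeping and the wandering of a gauge function over a region where the field is `1` -/

section Dist1

variable {G : Type*} [GaugeGroup G]

/-- `|g⁻¹h − 1| = |hg⁻¹ − 1|` (conjugation invariance of `dist1`). [folklore] -/
private theorem dist1_inv_mul_comm (g h : G) : dist1 (g⁻¹ * h) = dist1 (h * g⁻¹) := by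
  have e1 : g⁻¹ * (h * g⁻¹) * g⁻¹⁻¹ = g⁻¹ * h := by group
  rw [← e1]
  exact GaugeGroup.dist1_conj _ _

/-- `|g⁻¹h − 1| = |gh⁻¹ − 1|`. [folklore] -/
private theorem dist1_inv_mul_eq_dist1_mul_inv (g h : G) : dist1 (g⁻¹ * h) = dist1 (g * h⁻¹) := by
  rw [dist1_inv_mul_comm, ← GaugeGroup.dist1_inv, mul_inv_rev, inv_inv]

/-- The chain rule `|g₁⁻¹g₃ − 1| ≤ |g₁⁻¹g₂ − 1| + |g₂⁻¹g₃ − 1|`. [folklore] -/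
private theorem dist1_inv_mul_triangle (g₁ g₂ g₃ : G) : dist1 (g₁⁻¹ * g₃) ≤ dist1 (g₁⁻¹ * g₂) + dist1 (g₂⁻¹ * g₃) := by
  have e1 : g₁⁻¹ * g₃ = g₁⁻¹ * g₂ * (g₂⁻¹ * g₃) := by group
  rw [e1]
  exact GaugeGroup.dist1_mul_le _ _

/-- Pattern (ii) of §2 (source fixed, target moved): `|W_b (a₀⁻¹a_t)⁻¹ − 1| ≤ |a_s W_b a_t⁻¹ − 1| + |a₀⁻¹a_s − 1|`. [folklore] -/
private theorem dist1_pattern_src (as' at' a0 Wb : G) {η D : ℝ} (hg : dist1 (as' * Wb * at'⁻¹) ≤ η) (hD : dist1 (a0⁻¹ * as') ≤ D) :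
    dist1 (1 * Wb * (a0⁻¹ * at')⁻¹) ≤ η + D := by
  have e1 : (1 : G) * Wb * (a0⁻¹ * at')⁻¹ = (as'⁻¹ * (as' * Wb * at'⁻¹) * as'⁻¹⁻¹) * (as'⁻¹ * a0) := by group
  rw [e1]
  refine (GaugeGroup.dist1_mul_le _ _).trans (add_le_add ?_ ?_)
  · rw [GaugeGroup.dist1_conj]; exact hg
  · rw [← GaugeGroup.dist1_inv, mul_inv_rev, inv_inv]; exact hD

/-- Pattern (iii) of §2 (source moved, target fixed): `|a₀⁻¹a_s W_b − 1| ≤ |a_s W_b a_t⁻¹ − 1| + |a₀⁻¹a_t − 1|`. [folklore] -/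
private theorem dist1_pattern_tgt (as' at' a0 Wb : G) {η D : ℝ} (hg : dist1 (as' * Wb * at'⁻¹) ≤ η) (hD : dist1 (a0⁻¹ * at') ≤ D) :
    dist1 (a0⁻¹ * as' * Wb * (1 : G)⁻¹) ≤ η + D := by
  have e1 : a0⁻¹ * as' * Wb * (1 : G)⁻¹ = (a0⁻¹ * (as' * Wb * at'⁻¹) * a0⁻¹⁻¹) * (a0⁻¹ * at') := by group
  rw [e1]
  refine (GaugeGroup.dist1_mul_le _ _).trans (add_le_add ?_ hD)
  rw [GaugeGroup.dist1_conj]; exact hg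

/-- Pattern (iv) of §2 (both ends moved): `|a₀⁻¹a_s W_b (a₀⁻¹a_t)⁻¹ − 1| = |a_s W_b a_t⁻¹ − 1|`. [folklore] -/
private theorem dist1_pattern_both (as' at' a0 Wb : G) : dist1 (a0⁻¹ * as' * Wb * (a0⁻¹ * at')⁻¹) = dist1 (as' * Wb * at'⁻¹) := by
  have e1 : a0⁻¹ * as' * Wb * (a0⁻¹ * at')⁻¹ = a0⁻¹ * (as' * Wb * at'⁻¹) * a0⁻¹⁻¹ := by group
  rw [e1, GaugeGroup.dist1_conj]

end Dist1

section Wander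

variable {P : Params} {j : ℕ} {G : Type*} [GaugeGroup G]

omit [GaugeGroup G] in
/-- `∑_κ e_μ(κ) = 1` on `ℤ^d`. [folklore] -/
private theorem sum_e (μ : Fin P.d) : ∑ κ, e μ κ = (1 : ℤ) := by
  simp [e_apply]

/-- ★ **THE WANDERING BOUND.**  If the gauge-transformed configuration `W^a` is `η`-near-flat on every bond `⟨x, x + e_μ⟩` of the
parallelepiped `[LO, HI]` and `W = 1` on the bonds of the sub-parallelepiped `[lo, hi]`, then the gauge function `a` wanders by at most
`|x − lo|₁·η` over `[lo, hi]`: `dist1 (a(lo)⁻¹ a(x)) ≤ (∑_κ (x_κ − lo_κ))·η ≤ m·η`. (Induction on the `ℓ¹`-distance: one lattice step inside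
`[lo, hi]` is a bond where `W = 1`, so `a(x′)a(x)⁻¹ = W^a(x′, x)` is `η`-close to `1`.) [folklore] -/
private theorem dist1_wander_le {LO HI lo hi : Fin P.d → ℤ} (hLO : LO ≤ lo) (hHI : hi ≤ HI)
    {W : GaugeField P j G} {a : GaugeTransf P j G} {η : ℝ} (hη : 0 ≤ η)
    (hflat : ∀ (x : Fin P.d → ℤ) (μ : Fin P.d), LO ≤ x → x + e μ ≤ HI →
      dist1 (GaugeField.gaugeAct a W ⟨castSite x, μ⟩) ≤ η)
    (h1 : ∀ (x : Fin P.d → ℤ) (μ : Fin P.d), lo ≤ x → x + e μ ≤ hi → W ⟨castSite x, μ⟩ = 1) :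
    ∀ (m : ℕ) (x : Fin P.d → ℤ), lo ≤ x → x ≤ hi → (∑ κ, (x κ - lo κ)) ≤ m →
      dist1 ((a (castSite lo))⁻¹ * a (castSite x)) ≤ m * η := by
  intro m
  induction m with
  | zero =>
    intro x hx hx' hsum
    have hnn : ∀ κ ∈ (Finset.univ : Finset (Fin P.d)), 0 ≤ x κ - lo κ := fun κ _ => by linarith [hx κ]
    have h0 : ∑ κ, (x κ - lo κ) = 0 := le_antisymm (by exact_mod_cast hsum) (Finset.sum_nonneg hnn)
    have hx0 : x = lo := by
      funext κ
      have := (Finset.sum_eq_zero_iff_of_nonneg hnn).1 h0 κ (Finset.mem_univ _)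
      linarith
    subst hx0
    simp [GaugeGroup.dist1_one]
  | succ m ih =>
    intro x hx hx' hsum
    by_cases hxlo : x = lo
    · subst hxlo
      rw [inv_mul_cancel, GaugeGroup.dist1_one]
      positivity
    -- a coordinate that can be lowered inside `[lo, hi]`
    obtain ⟨κ, hκ⟩ : ∃ κ, lo κ < x κ := by
      by_contra hne
      push Not at hne
      exact hxlo (funext fun κ => le_antisymm (hne κ) (hx κ))
    set x' : Fin P.d → ℤ := x - e κ with hx'def
    have hx'x : x' + e κ = x := by rw [hx'def]; abel
    have hlox' : lo ≤ x' := fun ι => by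
      rw [hx'def, Pi.sub_apply, e_apply]
      split_ifs with h
      · subst h; linarith
      · linarith [hx ι]
    have hx'hi : x' ≤ hi := fun ι => by
      rw [hx'def, Pi.sub_apply, e_apply]
      split_ifs <;> linarith [hx' ι]
    have hsum' : ∑ ι, (x' ι - lo ι) ≤ (m : ℤ) := by
      have e1 : ∑ ι, (x' ι - lo ι) = ∑ ι, (x ι - lo ι) - ∑ ι, e κ ι := by
        rw [← Finset.sum_sub_distrib]
        refine Finset.sum_congr rfl fun ι _ => ?_
        rw [hx'def, Pi.sub_apply]; ring
      rw [e1, sum_e]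
      push_cast at hsum
      linarith
    have hih := ih x' hlox' hx'hi hsum'
    -- the bond `⟨x′, x′ + e_κ⟩` lies inside `[lo, hi]`: `W = 1` there, and `W^a` is `η`-near-flat on it
    have hb := hflat x' κ (hLO.trans hlox') (by rw [hx'x]; exact hx'.trans hHI)
    have hW1 := h1 x' κ hlox' (by rw [hx'x]; exact hx')
    have htgt : (PBond.tgt ⟨castSite x', κ⟩ : Site P j) = castSite x := by
      rw [← hx'x, castSite_add_e]; rfl
    have hb' : dist1 ((a (castSite x'))⁻¹ * a (castSite x)) ≤ η := by
      have e2 : GaugeField.gaugeAct a W ⟨castSite x', κ⟩ = a (castSite x') * (a (castSite x))⁻¹ := by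
        rw [GaugeField.gaugeAct, htgt, hW1, mul_one]
      rw [dist1_inv_mul_eq_dist1_mul_inv, ← e2]
      exact hb
    calc dist1 ((a (castSite lo))⁻¹ * a (castSite x))
        ≤ dist1 ((a (castSite lo))⁻¹ * a (castSite x')) + dist1 ((a (castSite x'))⁻¹ * a (castSite x)) :=
          dist1_inv_mul_triangle _ _ _
      _ ≤ m * η + η := add_le_add hih hb'
      _ = (m + 1 : ℕ) * η := by push_cast; ring

end Wander

/-! ## §2  The normalising gauge: `u = 1` on `Λs`, `W^u` near-flat on every bond of the region parallelepiped -/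

section Box

variable {P : Params} {j : ℕ} {G : Type*} [GaugeGroup G]

/-- ★★ **THE NORMALISING GAUGE OF A PLAQUETTE-SMALL CONFIGURATION THAT IS `1` INSIDE A PARALLELEPIPED** (any `GaugeGroup`, torus level
`j`).  Let `Λs = castSite '' [lo, hi] ⊆ [LO, HI]`, the latter a non-wrapping parallelepiped of at most `n + 1` sites per direction
(`HI ≤ LO + n`, `n < sitesPerDir j`); let `W = 1` on every bond with both ends in `Λs` and `dist1 (W(∂p)) < ε` on the plaquettes of
`[LO, HI]` (`S₀ ⊇ boxPlaqs LO HI`).  Then there is a gauge transformation `u` with `u = 1` ON `Λs` and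
`dist1 (W^u(b)) ≤ (d·n + 1)·((d − 1)·n·ε)` for EVERY bond `b` of `[LO, HI]` — the bonds meeting `Λs` included.  Construction: `a` = the
corner axial gauge `axialGauge W LO HI` (`|W^a(b) − 1| ≤ (d − 1)nε` on every bond, `T4AxialGaugeSmallField`), `u := 1` on `Λs` and
`u := a(lo)⁻¹·a` off `Λs`; on a bond off `Λs` this is `W^a` conjugated by `a(lo)`, on a bond meeting `Λs` the defect is the wandering
`a(lo)⁻¹a(s)`, `s ∈ Λs`, of §1 (`≤ d·n·(d − 1)nε`).  This is p. 194's *«it is natural to consider it on orbits of this group»* made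
effective for the extended datum: the orbit of `W` under the gauges FIXING `Λs` pointwise contains a configuration near `1` on the whole
region. [cite: Balaban1989LargeFieldI, p.194 (sentence after (1.77)), p.193] -/
theorem exists_gauge_one_on_box_nearFlat {LO HI lo hi : Fin P.d → ℤ} (hLO : LO ≤ lo) (hHI : hi ≤ HI)
    {n : ℕ} (hn : ∀ κ, HI κ ≤ LO κ + n) (hnN : n < P.sitesPerDir j)
    {W : GaugeField P j G} {S₀ : Set (Plaq P j)} {ε : ℝ} (hε : 0 ≤ ε)
    (hS₀ : boxPlaqs LO HI ⊆ S₀) (hW : PlaqSmallOn S₀ ε W)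
    (h1 : ∀ b : PBond P j, b.src ∈ (castSite '' Set.Icc lo hi : Set (Site P j)) →
      b.tgt ∈ (castSite '' Set.Icc lo hi : Set (Site P j)) → W b = 1) :
    ∃ u : GaugeTransf P j G, (∀ s ∈ (castSite '' Set.Icc lo hi : Set (Site P j)), u s = 1) ∧
      ∀ b ∈ boxBonds LO HI, dist1 (GaugeField.gaugeAct u W b) ≤ ((P.d : ℝ) * n + 1) * (((P.d - 1 : ℕ) : ℝ) * n * ε) := by
  classical
  set Λs : Set (Site P j) := castSite '' Set.Icc lo hi with hΛs
  set a : GaugeTransf P j G := axialGauge W LO HI with ha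
  set η : ℝ := ((P.d - 1 : ℕ) : ℝ) * n * ε with hη
  have hη0 : 0 ≤ η := by positivity
  have hle_add_e : ∀ (x : Fin P.d → ℤ) (μ : Fin P.d), x ≤ x + e μ := fun x μ ι => by
    rw [Pi.add_apply, e_apply]; split_ifs <;> linarith
  -- the corner axial gauge: every bond of the region is `η`-near-flat
  have hflat : ∀ (x : Fin P.d → ℤ) (μ : Fin P.d), LO ≤ x → x + e μ ≤ HI →
      dist1 (GaugeField.gaugeAct a W ⟨castSite x, μ⟩) ≤ η := fun x μ hx hxμ =>
    dist1_gaugeAct_axialGauge_le_uniform W hS₀ hW hε hn hnN hx hxμ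
  have h1' : ∀ (x : Fin P.d → ℤ) (μ : Fin P.d), lo ≤ x → x + e μ ≤ hi → W ⟨castSite x, μ⟩ = 1 := fun x μ hx hxμ =>
    h1 _ ⟨x, ⟨hx, (hle_add_e x μ).trans hxμ⟩, rfl⟩ ⟨x + e μ, ⟨hx.trans (hle_add_e x μ), hxμ⟩, by
      rw [castSite_add_e]; rfl⟩
  -- the wandering of `a` over `Λs`
  have hwander : ∀ s ∈ Λs, dist1 ((a (castSite lo))⁻¹ * a s) ≤ (P.d : ℝ) * n * η := by
    rintro s ⟨x, ⟨hx, hx'⟩, rfl⟩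
    have hsum : ∑ κ, (x κ - lo κ) ≤ ((P.d * n : ℕ) : ℤ) := by
      have hterm : ∀ κ ∈ (Finset.univ : Finset (Fin P.d)), x κ - lo κ ≤ (n : ℤ) := fun κ _ => by
        linarith [hx' κ, hHI κ, hLO κ, hn κ]
      calc ∑ κ, (x κ - lo κ) ≤ ∑ _κ : Fin P.d, (n : ℤ) := Finset.sum_le_sum hterm
        _ = ((P.d * n : ℕ) : ℤ) := by simp
    have h := dist1_wander_le hLO hHI hη0 hflat h1' (P.d * n) x hx hx' hsum
    push_cast at h
    exact h
  refine ⟨fun s => if s ∈ Λs then 1 else (a (castSite lo))⁻¹ * a s, fun s hs => if_pos hs, ?_⟩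
  rintro b ⟨x, hx, hxμ, hsrc⟩
  obtain ⟨src, μ⟩ := b
  simp only at hsrc hxμ
  subst hsrc
  have htgt : (PBond.tgt ⟨castSite x, μ⟩ : Site P j) = castSite (x + e μ) := by
    rw [castSite_add_e]; rfl
  have hg : dist1 (a (castSite x) * W ⟨castSite x, μ⟩ * (a (castSite (x + e μ)))⁻¹) ≤ η := by
    have h := hflat x μ hx hxμ
    rwa [GaugeField.gaugeAct, htgt] at h
  have hdn : (P.d : ℝ) * n * η ≤ (P.d : ℝ) * n * η := le_rfl
  have hbound : η + (P.d : ℝ) * n * η = ((P.d : ℝ) * n + 1) * η := by ring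
  have hηle : η ≤ ((P.d : ℝ) * n + 1) * η := by
    have : (0 : ℝ) ≤ (P.d : ℝ) * n * η := by positivity
    linarith
  show dist1 ((if castSite x ∈ Λs then 1 else (a (castSite lo))⁻¹ * a (castSite x)) * W ⟨castSite x, μ⟩ *
    ((if (PBond.tgt ⟨castSite x, μ⟩ : Site P j) ∈ Λs then 1 else (a (castSite lo))⁻¹ * a (PBond.tgt ⟨castSite x, μ⟩)))⁻¹) ≤ _
  rw [htgt]
  by_cases hs : (castSite x : Site P j) ∈ Λs <;> by_cases ht : (castSite (x + e μ) : Site P j) ∈ Λs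
  · -- both ends in `Λs`: `W = 1`
    rw [if_pos hs, if_pos ht, h1 ⟨castSite x, μ⟩ hs (by rw [htgt]; exact ht)]
    simp only [mul_one, inv_one, GaugeGroup.dist1_one]
    positivity
  · -- source in `Λs`, target off it
    rw [if_pos hs, if_neg ht, ← hbound]
    exact dist1_pattern_src _ _ _ _ hg (hwander _ hs)
  · -- source off `Λs`, target in it
    rw [if_neg hs, if_pos ht, ← hbound]
    exact dist1_pattern_tgt _ _ _ _ hg (hwander _ ht)
  · -- both ends off `Λs`: `W^a` conjugated by `a(lo)`
    rw [if_neg hs, if_neg ht, dist1_pattern_both]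
    exact hg.trans hηle

end Box

/-! ## §3  The exact transport of the slice function along gauges fixing the sources of the free bonds; the incoming bonds -/

section Incoming

variable {P : Params} {k : ℕ} {G : Type*} [GaugeGroup G]

/-- **PRINT'S PURE GAUGE ON AN INCOMING BOND**: for a bond `b = ⟨y, y′⟩` with `y ∉ Λ`, `y′ ∈ Λ`, the p. 193 extension is
`Ṽ(b) = g(y)⁻¹` (*«Now we apply the inverse gauge transformation on ∂⁺Λ»* — the extended `V′ = 1` on the bonds meeting `Λ`, transformed
back by the surface gauge `g`, cut off to `1` on `Λ`). [cite: Balaban1989LargeFieldI, p.193] -/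
theorem extend_apply_of_incoming (Λs : Set (Site P k)) (g : GaugeTransf P k G) (V : GaugeField P k G) {b : PBond P k}
    (hsrc : b.src ∉ Λs) (htgt : b.tgt ∈ Λs) : extend Λs g V b = (g b.src)⁻¹ := by
  rw [extend_of_touches g V (Or.inr htgt : Touches Λs b), cutoff_of_not_mem g hsrc, cutoff_of_mem g htgt, mul_one]

/-- **PRINT'S PURE GAUGE ON AN OUTGOING BOND**: for `b = ⟨y′, y⟩` with `y′ ∈ Λ`, `y ∉ Λ`, `Ṽ(b) = g(y)`. [cite: Balaban1989LargeFieldI, p.193] -/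
theorem extend_apply_of_outgoing (Λs : Set (Site P k)) (g : GaugeTransf P k G) (V : GaugeField P k G) {b : PBond P k}
    (hsrc : b.src ∈ Λs) (htgt : b.tgt ∉ Λs) : extend Λs g V b = g b.tgt := by
  rw [extend_of_touches g V (Or.inl hsrc : Touches Λs b), cutoff_of_mem g hsrc, cutoff_of_not_mem g htgt, inv_one, one_mul]

omit [GaugeGroup G] in
/-- An incoming bond (`b₊ ∈ S`) outside the tree `T` is a FREE bond of the slice (`freeBonds S T = bondsOf S ∖ T`,
`bondsOf S = {b₋ ∈ S ∨ b₊ ∈ S}`). [cite: Balaban1989LargeFieldII, p.359 («B′ satisfying the gauge condition B′↾_{G₀} = 0»)] -/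
theorem mem_freeBonds_of_incoming {S : Set (Site P k)} {T : Finset (PBond P k)} {b : PBond P k} (htgt : b.tgt ∈ S) (hT : b ∉ T) :
    b ∈ freeBonds S T :=
  mem_freeBonds.2 ⟨Or.inr htgt, hT⟩

omit [GaugeGroup G] in
/-- If the tree `T` contains every incoming bond (`b₋ ∉ S`, `b₊ ∈ S`), then every free bond has its SOURCE in `S` — the hypothesis
under which §3's transport is exact for gauges equal to `1` on `S`. [cite: Balaban1989LargeFieldII, p.359] -/
theorem src_mem_of_mem_freeBonds_of_incoming_subset {S : Set (Site P k)} {T : Finset (PBond P k)}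
    (hT : ∀ b : PBond P k, b.src ∉ S → b.tgt ∈ S → b ∈ T) {b : PBond P k} (hb : b ∈ freeBonds S T) : b.src ∈ S := by
  obtain ⟨hbS, hbT⟩ := mem_freeBonds.1 hb
  rcases hbS with h | h
  · exact h
  · by_contra hs
    exact hbT (hT b hs h)

end Incoming

section Transport

variable {P : Params} {k : ℕ} {G : Type*} [GaugeGroup G]
  {𝔤 : Type*} [NormedAddCommGroup 𝔤] [InnerProductSpace ℝ 𝔤]

/-- ★ **THE CHART PERTURBATION COMMUTES WITH GAUGES FIXING THE SOURCES OF THE FREE BONDS**: if `u(b₋) = 1` for every free bond `b`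
of the slice `(S, T)`, then `exp(i·ιA Y)·(W^u) = (exp(i·ιA Y)·W)^u` for every coordinate vector `Y` (any exponential chart: `exp 0 = 1`
handles the bonds where `ιA Y = 0`; on a free bond the left factor `u(b₋) = 1` commutes with everything).  The compensating adjoint
transformation of [B16] p. 357 is trivial for such `u`. [cite: Balaban1989LargeFieldII, p.357 («the compensating adjoint gauge transformation on the variables B′»), p.359; Balaban1985Averaging, (8) p.19] -/
theorem expMul_gaugeAct_of_src (ch : ExpChart G 𝔤) (S : Set (Site P k)) (T : Finset (PBond P k)) (u : GaugeTransf P k G)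
    (hu : ∀ b ∈ freeBonds S T, u b.src = 1) (Y : GaugeSlice S T 𝔤) (W : GaugeField P k G) :
    expMul ch (ιA S T Y) (GaugeField.gaugeAct u W) = GaugeField.gaugeAct u (expMul ch (ιA S T Y) W) := by
  funext b
  by_cases hb : b ∈ freeBonds S T
  · simp only [expMul, GaugeField.gaugeAct, hu b hb, one_mul, mul_assoc]
  · simp only [expMul, GaugeField.gaugeAct, ιA_apply_of_not_mem Y hb, ch.iexp_zero, one_mul, mul_assoc]

/-- ★★ **THE GAUGE-FIXED SLICE FUNCTION IS THE SAME AT `W` AND AT `W^u`** for a gauge-invariant `f` ([B7] (12)) and a gauge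
transformation `u` equal to `1` at the source of every free bond: `sliceFn S T f (W^u) = sliceFn S T f W` AS FUNCTIONS of the coordinate
vector — hence every derivative, Hessian pairing and one-sided Hessian clause of the slice function agrees at the two data.  This is
p. 194's *«The function is invariant with respect to the group of all gauge transformations defined on Λ, hence it is natural to
consider it on orbits of this group»* in the gauge-fixed coordinates of [LF-II] p. 359. [cite: Balaban1989LargeFieldI, p.194 (sentence after (1.77)); Balaban1989LargeFieldII, p.359] -/
theorem sliceFn_gaugeAct_of_src (S : Set (Site P k)) (T : Finset (PBond P k)) {f : GaugeField P k SU2 → ℝ} (hf : GaugeInvariant f)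
    (u : GaugeTransf P k SU2) (hu : ∀ b ∈ freeBonds S T, u b.src = 1) (W : GaugeField P k SU2) :
    sliceFn S T f (GaugeField.gaugeAct u W) = sliceFn S T f W := by
  funext Y
  rw [sliceFn_apply, sliceFn_apply, expMul_gaugeAct_of_src su2Chart S T u hu Y W, hf u]

/-- The same under the tree hypothesis «`T` contains every incoming bond» and `u = 1` on `S`. [cite: Balaban1989LargeFieldI, p.194; Balaban1989LargeFieldII, p.359] -/
theorem sliceFn_gaugeAct_of_eq_one_on (S : Set (Site P k)) (T : Finset (PBond P k)) {f : GaugeField P k SU2 → ℝ} (hf : GaugeInvariant f)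
    (hT : ∀ b : PBond P k, b.src ∉ S → b.tgt ∈ S → b ∈ T)
    (u : GaugeTransf P k SU2) (hu : ∀ s ∈ S, u s = 1) (W : GaugeField P k SU2) :
    sliceFn S T f (GaugeField.gaugeAct u W) = sliceFn S T f W :=
  sliceFn_gaugeAct_of_src S T hf u (fun _ hb => hu _ (src_mem_of_mem_freeBonds_of_incoming_subset hT hb)) W

/-- ★★ **AT THE BACKGROUND OF RECORD** (`f = fun177std (bgMSCoPOfRecord F 2 ν Kt k′ Ω) M₁ Z k`, `k ≤ m + K` — the function of the
lane's endpoint `B15Prop1EndpointNearFlatLetters`): the slice function is the same at `W` and at `W^u` for every gauge transformation `u`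
of `T^{(k)}` equal to `1` at the sources of the free bonds — UNCONDITIONALLY, the value invariance being
`B15Eq177ValueInvarianceCoDiv.fun177std_bgMSCoPOfRecord_gaugeAct`. [cite: Balaban1989LargeFieldI, (1.77) and the sentence after it, p.194] -/
theorem sliceFn_fun177std_bgMSCoPOfRecord_gaugeAct_of_src {F : T4Family} (ν : Stage7Numerics) (Kt k' : ℕ)
    (Ω : ℕ → Set (Site (F.P Kt) 0)) (M₁ : ℕ) (Z : Set (Site (F.P Kt) 0)) {k : ℕ} (hk : k ≤ (F.P Kt).m + (F.P Kt).K)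
    (S : Set (Site (F.P Kt) k)) (T : Finset (PBond (F.P Kt) k))
    (u : GaugeTransf (F.P Kt) k SU2) (hu : ∀ b ∈ freeBonds S T, u b.src = 1) (W : GaugeField (F.P Kt) k SU2) :
    sliceFn S T (fun177std (bgMSCoPOfRecord F 2 ν Kt k' Ω) M₁ Z k) (GaugeField.gaugeAct u W)
      = sliceFn S T (fun177std (bgMSCoPOfRecord F 2 ν Kt k' Ω) M₁ Z k) W :=
  sliceFn_gaugeAct_of_src S T (fun u' V => fun177std_bgMSCoPOfRecord_gaugeAct ν Kt k' Ω M₁ Z hk u' V) u hu W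

end Transport

/-! ## §4  At the objects of Proposition 1: the normalising gauge for print's extension `Ṽ_k` -/

section Record

variable {P : Params} {k : ℕ} {G : Type*} [GaugeGroup G]

/-- ★★★ **THE NORMALISING GAUGE FOR THE EXTENDED DATUM OF PROPOSITION 1** (any `GaugeGroup`, `d ≥ 3`).  Objects: the parallelepiped
`Λ^{(k)} = castSite '' [lo, hi]` of at most `n + 1` sites per direction, non-wrapping with margin (`hi − lo + 3 < sitesPerDir`), whose
enlarged box lies in `Z^{(k)}` (`hZ`); a base field `V_k` in the (1.74) guard `|V_k(∂p′) − 1| < ε` for `p′ ⊂ (Z ∩ Λᶜ)^{(k)}` (`0 < ε`); print's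
extension `Ṽ_k = extend (pts k Λ) (shellGauge V_k lo hi) V_k` of p. 193; and a region parallelepiped `[LO, HI] ⊇ [lo, hi]` of at most
`n′ + 1` sites per direction, non-wrapping (`n′ < sitesPerDir`), whose plaquettes lie in `Z^{(k)}` (`hR`).  Conclusion: there is a gauge
transformation `u` of `T^{(k)}` with `u = 1` ON `Λ^{(k)}` and `|Ṽ_k^u(b) − 1| ≤ (d·n′ + 1)(d − 1)n′·(12d(n + 2)² + 1)·ε` on EVERY bond of
`[LO, HI]`.  (`Ṽ_k = 1` on the bonds inside `Λ^{(k)}` by construction; its plaquettes in `Z^{(k)}` are `12d(n + 2)²ε`-small by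
`B15ShellGauge193Local.dist1_plaqHol_extend_shellGauge_le`; then §2.)  Since `u = 1` on `Λ^{(k)}`, `Ṽ_k^u` is again `1` inside `Λ^{(k)}`,
its plaquette variables are those of `Ṽ_k` conjugated, and the (1.74) guard is kept by `V_k^u` (`T4ReTrLipUnitary.plaqSmallOn_gaugeAct_iff`).
[cite: Balaban1989LargeFieldI, p.193, p.194 (sentence after (1.77))] -/
theorem exists_gauge_normalising_extend (hd : 3 ≤ P.d) {lo hi : Fin P.d → ℤ} (hlohi : lo ≤ hi) {n : ℕ}
    (hn : ∀ κ, hi κ ≤ lo κ + n) (hN : ∀ κ, hi κ - lo κ + 3 < (P.sitesPerDir k : ℤ)) {Z Λ : Set (Site P 0)}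
    (hbox : pts k Λ = (castSite '' Set.Icc lo hi : Set (Site P k)))
    (hZ : (boxPlaqs (lo - 1) (hi + 1) : Set (Plaq P k)) ⊆ plaqsInside (pts k Z))
    {LO HI : Fin P.d → ℤ} (hLO : LO ≤ lo) (hHI : hi ≤ HI) {n' : ℕ} (hn' : ∀ κ, HI κ ≤ LO κ + n')
    (hn'N : n' < P.sitesPerDir k) (hR : (boxPlaqs LO HI : Set (Plaq P k)) ⊆ plaqsInside (pts k Z))
    {ε : ℝ} (hε : 0 < ε) {V : GaugeField P k G} (hreg : PlaqSmallOn (plaqsInside (pts k (Z ∩ Λᶜ))) ε V) :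
    ∃ u : GaugeTransf P k G, (∀ s ∈ pts k Λ, u s = 1) ∧
      ∀ b ∈ boxBonds LO HI, dist1 (GaugeField.gaugeAct u (extend (pts k Λ) (shellGauge V lo hi) V) b)
        ≤ ((P.d : ℝ) * n' + 1) * (((P.d - 1 : ℕ) : ℝ) * n' * ((12 * P.d * (n + 2) ^ 2 + 1) * ε)) := by
  set W : GaugeField P k G := extend (pts k Λ) (shellGauge V lo hi) V with hWdef
  -- the plaquettes of `Ṽ_k` inside `Z^{(k)}`
  obtain ⟨hplaq, -⟩ := dist1_plaqHol_extend_shellGauge_le (G := G) hd hlohi hn hN hbox hZ hε hreg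
  have hW : PlaqSmallOn (plaqsInside (pts k Z)) ((12 * P.d * (n + 2) ^ 2 + 1) * ε) W := fun p hp =>
    calc dist1 (plaqHol W p) ≤ 12 * P.d * (n + 2) ^ 2 * ε := hplaq p hp
      _ < (12 * P.d * (n + 2) ^ 2 + 1) * ε := by nlinarith
  -- `Ṽ_k = 1` on the bonds inside `Λ^{(k)}`
  have h1 : ∀ b : PBond P k, b.src ∈ (castSite '' Set.Icc lo hi : Set (Site P k)) →
      b.tgt ∈ (castSite '' Set.Icc lo hi : Set (Site P k)) → W b = 1 := fun b hs ht =>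
    extend_of_mem_of_mem (shellGauge V lo hi) V (by rw [hbox]; exact hs) (by rw [hbox]; exact ht)
  have hε' : (0 : ℝ) ≤ (12 * P.d * (n + 2) ^ 2 + 1) * ε := by positivity
  obtain ⟨u, hu1, hu⟩ := exists_gauge_one_on_box_nearFlat hLO hHI hn' hn'N hε' hR hW h1
  refine ⟨u, fun s hs => hu1 s (by rw [← hbox]; exact hs), hu⟩

/-- `dist1` on `SU(2)` is the lane's matrix norm `‖U − 1‖` (operator norm through the fundamental representation; `rfl`) — the reading of
§4's bound in the currency of `B15Prop1EndpointNearFlatLetters`' letter `hU` ([B7] (19): the operator norm `|U − 1|`).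
[cite: Balaban1985Averaging, (19) p.21] -/
theorem dist1_eq_norm_sub_one_su2 (U : SU2) :
    dist1 U = ‖((U : SU2) : Matrix (Fin 2) (Fin 2) ℂ) - (1 : Matrix (Fin 2) (Fin 2) ℂ)‖ := by
  rfl

end Record

/-! ## §5  (v1.1) The p. 193 extension COMMUTES with the gauges fixing `Λ^{(k)}` and the shell corner: `Ṽ(V^u) = Ṽ(V)^u` -/

section ExtendComm

variable {P : Params} {k : ℕ} {G : Type*} [GaugeGroup G] {lo hi : Fin P.d → ℤ}

open T4AxialGaugeSmallField (pull pull_apply)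
open B15ShellGauge193 (shellFn shellGauge_castSite bot_add_disp_pathWord)
open B7Prop1Explicit (hol_gaugeAct)
open B15Extension193 (outBonds extend_eq_of_mem_outBonds)

omit [GaugeGroup G] in
/-- `y ↦ y + e_μ` is injective on the torus (private copy of r12's bookkeeping). [folklore] -/
private theorem shift_injective (μ : Fin P.d) : Function.Injective fun x : Site P k => x.shift μ := by
  intro x y h
  funext ν
  have hν := congrFun h ν
  by_cases hm : ν = μ
  · subst hm
    simpa [Site.shift, Function.update_self] using hν
  · simpa [Site.shift, Function.update_of_ne hm] using hν

omit [GaugeGroup G] in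
/-- `e_μ` is coordinatewise in `[0, 1]`. [folklore] -/
private theorem e_bounds (μ κ : Fin P.d) : (0 : ℤ) ≤ e μ κ ∧ e μ κ ≤ 1 := by
  rw [e_apply]; split_ifs <;> simp

/-- **THE PULL-BACK OF A GAUGE-TRANSFORMED CONFIGURATION** is the `ℤ^d` gauge transform of the pull-back by `u ∘ castSite` ([B7] (8) read through
the periodic projection). [cite: Balaban1985Averaging, (8) p.19] -/
theorem pull_gaugeAct (u : GaugeTransf P k G) (V : GaugeField P k G) :
    pull (GaugeField.gaugeAct u V) = B7Prop1Explicit.gaugeAct (fun z => u (castSite z)) (pull V) := by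
  funext z μ
  simp only [pull_apply, GaugeField.gaugeAct, B7Prop1Explicit.gaugeAct, PBond.tgt, castSite_add_e]

/-- **THE SHELL GAUGE FUNCTION IS GAUGE COVARIANT**: `g_{V^ũ}(y) = ũ(lo − 1)·g_V(y)·ũ(y)⁻¹` — the parallel transport along r12's shell path `Γ_y`
from the corner `lo − 1` transforms by [B7] (8) at its two ends. [cite: Balaban1985Averaging, (8)–(9) p.19; Balaban1989LargeFieldI, p.193] -/
theorem shellFn_gaugeAct {d : ℕ} (ũ : (Fin d → ℤ) → G) (V : (Fin d → ℤ) → Fin d → G) (lo hi y : Fin d → ℤ) :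
    shellFn (B7Prop1Explicit.gaugeAct ũ V) lo hi y = ũ (lo - 1) * shellFn V lo hi y * (ũ y)⁻¹ := by
  unfold shellFn
  rw [hol_gaugeAct, bot_add_disp_pathWord]

/-- … hence, on the big box `[lo − 1, hi + 1]` of a non-wrapping parallelepiped, the torus shell gauge of p. 193 transforms as
`g_{V^u}(s) = u(c₀)·g_V(s)·u(s)⁻¹`, `c₀ = castSite (lo − 1)` the corner of the big box. [cite: Balaban1989LargeFieldI, p.193; Balaban1985Averaging, (8) p.19] -/
theorem shellGauge_gaugeAct_castSite (hN : ∀ κ, hi κ - lo κ + 3 < (P.sitesPerDir k : ℤ)) (u : GaugeTransf P k G)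
    (V : GaugeField P k G) {x : Fin P.d → ℤ} (hx : lo - 1 ≤ x) (hx' : x ≤ hi + 1) :
    shellGauge (GaugeField.gaugeAct u V) lo hi (castSite x)
      = u (castSite (lo - 1)) * shellGauge V lo hi (castSite x) * (u (castSite x))⁻¹ := by
  rw [shellGauge_castSite _ hN hx hx', shellGauge_castSite _ hN hx hx', pull_gaugeAct, shellFn_gaugeAct]

/-- ★★ **THE p. 193 EXTENSION COMMUTES WITH THE GAUGES FIXING `Λ^{(k)}` AND THE SHELL CORNER**: for a gauge transformation `u` of `T^{(k)}`
with `u = 1` on `Λ^{(k)} = castSite '' [lo, hi]` and `u(castSite (lo − 1)) = 1`,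
`extend Λ^{(k)} (shellGauge (V^u) lo hi) (V^u) = (extend Λ^{(k)} (shellGauge V lo hi) V)^u` — off the bonds meeting `Λ^{(k)}` both sides are
`V^u` (*«equal to the given one on Z∩Λ^c»*), inside both are `1`, and on a bond meeting `Λ^{(k)}` from∕to a shell point `y` both are the pure
gauge `g_V(y)^{∓1}` moved by `u(y)` (§5 `shellGauge_gaugeAct_castSite`).  So a normalisation of `V_k` by such `u` normalises the extended
datum by the SAME `u` — p. 194's orbit remark may be applied to `V_k` itself (the (1.74) guard is gauge invariant,
`T4ReTrLipUnitary.plaqSmallOn_gaugeAct_iff`). [cite: Balaban1989LargeFieldI, p.193, p.194 (sentence after (1.77))] -/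
theorem extend_gaugeAct_of_eq_one (hN : ∀ κ, hi κ - lo κ + 3 < (P.sitesPerDir k : ℤ))
    (u : GaugeTransf P k G) (V : GaugeField P k G)
    (hu : ∀ s ∈ (castSite '' Set.Icc lo hi : Set (Site P k)), u s = 1) (hu₀ : u (castSite (lo - 1)) = 1) :
    extend (castSite '' Set.Icc lo hi) (shellGauge (GaugeField.gaugeAct u V) lo hi) (GaugeField.gaugeAct u V)
      = GaugeField.gaugeAct u (extend (castSite '' Set.Icc lo hi) (shellGauge V lo hi) V) := by
  set Λs : Set (Site P k) := castSite '' Set.Icc lo hi with hΛs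
  funext b
  rw [show GaugeField.gaugeAct u (extend Λs (shellGauge V lo hi) V) b
      = u b.src * extend Λs (shellGauge V lo hi) V b * (u b.tgt)⁻¹ from rfl]
  by_cases hs : b.src ∈ Λs <;> by_cases ht : b.tgt ∈ Λs
  · -- both ends in `Λ`: `1 = 1·1·1⁻¹`
    rw [extend_of_mem_of_mem _ _ hs ht, extend_of_mem_of_mem _ _ hs ht, hu _ hs, hu _ ht, one_mul, inv_one, mul_one]
  · -- outgoing bond `⟨s, y⟩`, `s ∈ Λ`, `y` in the shell: both sides `g_V(y)·u(y)⁻¹`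
    obtain ⟨x, ⟨hx, hx'⟩, hsrc⟩ := id hs
    have htgt : b.tgt = castSite (x + e b.dir) := by
      rw [castSite_add_e, PBond.tgt, hsrc]
    have hbig : lo - 1 ≤ x + e b.dir ∧ x + e b.dir ≤ hi + 1 := ⟨fun κ => by
      have := (e_bounds b.dir κ).1; rw [Pi.sub_apply, Pi.one_apply, Pi.add_apply]; linarith [hx κ],
      fun κ => by have := (e_bounds b.dir κ).2; rw [Pi.add_apply, Pi.add_apply, Pi.one_apply]; linarith [hx' κ]⟩
    rw [extend_apply_of_outgoing Λs _ _ hs ht, extend_apply_of_outgoing Λs _ _ hs ht, htgt,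
      shellGauge_gaugeAct_castSite hN u V hbig.1 hbig.2, hu₀, hu _ hs, one_mul]
  · -- incoming bond `⟨y, t⟩`, `y` in the shell, `t ∈ Λ`: both sides `u(y)·g_V(y)⁻¹`
    obtain ⟨x, ⟨hx, hx'⟩, htgt⟩ := id ht
    have hsrc : b.src = castSite (x - e b.dir) := by
      apply shift_injective b.dir
      show b.src.shift b.dir = (castSite (x - e b.dir)).shift b.dir
      rw [← castSite_add_e, sub_add_cancel]
      exact htgt.symm
    have hbig : lo - 1 ≤ x - e b.dir ∧ x - e b.dir ≤ hi + 1 := ⟨fun κ => by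
      have := (e_bounds b.dir κ).2; rw [Pi.sub_apply, Pi.one_apply, Pi.sub_apply]; linarith [hx κ],
      fun κ => by have := (e_bounds b.dir κ).1; rw [Pi.sub_apply, Pi.add_apply, Pi.one_apply]; linarith [hx' κ]⟩
    rw [extend_apply_of_incoming Λs _ _ hs ht, extend_apply_of_incoming Λs _ _ hs ht, hsrc,
      shellGauge_gaugeAct_castSite hN u V hbig.1 hbig.2, hu₀, one_mul, mul_inv_rev, inv_inv, ← hsrc, hu _ ht, inv_one, mul_one]
  · -- both ends off `Λ`: *«equal to the given one on Z∩Λ^c»*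
    have hb : b ∈ outBonds Λs := ⟨hs, ht⟩
    rw [extend_eq_of_mem_outBonds _ _ hb, extend_eq_of_mem_outBonds _ _ hb]
    rfl

end ExtendComm

/-! ## §6  (v1.1) The slice transport along an ARBITRARY gauge of `T^{(k)}`: the bondwise adjoint rotation of the coordinates -/

section AdTransport

variable {P : Params} {k : ℕ}

open B15Prop1ChartSU2 (adSU2 adSU2_apply iexp_adSU2)
open B15Prop1ChartCalculusSU2 (imQuat_adSU2 adSU2_inv_adSU2 adSU2_adSU2_inv)
open T4HaarSU2ExpChart (imQuat norm_imQuat)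
open Literature.MathematicalPhysics.QuantumLattice (su2Quat norm_su2Quat)

/-- `Ad_g` is an isometry of `ℝ³`: `‖q·ιX·q⁻¹‖ = ‖ιX‖ = ‖X‖` for the unit quaternion `q` of `g` (pv26/g2's private lemma of `B15Prop1ChartSU2`,
re-proved for use). [cite: Balaban1989LargeFieldI, (1.77) p.194] -/
theorem norm_adSU2_eq (g : SU2) (X : E3) : ‖adSU2 g X‖ = ‖X‖ := by
  rw [← norm_imQuat (adSU2 g X), imQuat_adSU2, norm_mul, norm_mul, norm_inv, norm_su2Quat, norm_imQuat]
  simp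

/-- ★ **THE CHART PERTURBATION ALONG AN ARBITRARY GAUGE — THE COMPENSATING ADJOINT TRANSFORMATION** ([B16] p. 357 *«We also have to do the
compensating adjoint gauge transformation on the variables B′»*): for EVERY gauge transformation `u` of `T^{(k)}` and every bond field `A`,
`exp(i·A)·(W^u) = (exp(i·Ad_{u(·₋)⁻¹}A)·W)^u` bondwise, `(Ad_{u(·₋)⁻¹}A)_b = Ad_{u(b₋)⁻¹}(A_b)` (`B15Prop1ChartSU2.iexp_adSU2`). [cite: Balaban1989LargeFieldII, p.357; Balaban1985BackgroundPropagators, (3.29) p.395] -/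
theorem expMul_gaugeAct_eq_gaugeAct_expMul_ad (u : GaugeTransf P k SU2) (A : VecField P k E3) (W : GaugeField P k SU2) :
    expMul su2Chart A (GaugeField.gaugeAct u W)
      = GaugeField.gaugeAct u (expMul su2Chart (fun b => adSU2 (u b.src)⁻¹ (A b)) W) := by
  funext b
  simp only [expMul, GaugeField.gaugeAct, iexp_adSU2, inv_inv]
  group

/-- ★★ **THE GAUGE-FIXED SLICE FUNCTION ALONG AN ARBITRARY GAUGE**: for a gauge-invariant `f` and EVERY gauge transformation `u` of
`T^{(k)}` there is a linear ISOMETRY `R` of the slice `GaugeSlice S T ℝ³` — the bondwise rotation `(R Y)_b = Ad_{u(b₋)⁻¹}(Y_b)` on the free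
bonds — with `sliceFn S T f (W^u) = sliceFn S T f W ∘ R`.  (On the free bonds whose source `u` fixes, `R` is the identity — §3's exact
edition; in general the norm `‖Y‖` and every Hessian pairing transport along `R`, quantities built from the coordinates bond by bond with
different source points — e.g. a lattice curl — do not.)  This is p. 194's orbit sentence for the WHOLE gauge group of `T^{(k)}` in the
coordinates of [LF-II] p. 359. [cite: Balaban1989LargeFieldI, p.194 (sentence after (1.77)); Balaban1989LargeFieldII, p.357, p.359] -/
theorem exists_adSlice_sliceFn_gaugeAct (S : Set (Site P k)) (T : Finset (PBond P k)) {f : GaugeField P k SU2 → ℝ}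
    (hf : GaugeInvariant f) (u : GaugeTransf P k SU2) (W : GaugeField P k SU2) :
    ∃ R : GaugeSlice S T E3 ≃ₗᵢ[ℝ] GaugeSlice S T E3,
      (∀ (Y : GaugeSlice S T E3) (b : ↥(freeBonds S T)), R Y b = adSU2 (u b.1.src)⁻¹ (Y b)) ∧
      ∀ Y : GaugeSlice S T E3, sliceFn S T f (GaugeField.gaugeAct u W) Y = sliceFn S T f W (R Y) := by
  -- the rotation `Ad_g` of `ℝ³` as a linear isometry equivalence
  let A : SU2 → (E3 ≃ₗᵢ[ℝ] E3) := fun g =>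
    { toLinearEquiv :=
        { adSU2 g with
          invFun := adSU2 g⁻¹
          left_inv := fun X => adSU2_inv_adSU2 g X
          right_inv := fun X => adSU2_adSU2_inv g X }
      norm_map' := norm_adSU2_eq g }
  have hA : ∀ g X, A g X = adSU2 g X := fun g X => rfl
  refine ⟨LinearIsometryEquiv.piLpCongrRight 2 (fun b : ↥(freeBonds S T) => A (u b.1.src)⁻¹), fun Y b => ?_, fun Y => ?_⟩
  · rw [LinearIsometryEquiv.piLpCongrRight_apply]
    rfl
  · have hι : (fun b => adSU2 (u b.src)⁻¹ (ιA S T Y b))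
        = ιA S T (LinearIsometryEquiv.piLpCongrRight 2 (fun b : ↥(freeBonds S T) => A (u b.1.src)⁻¹) Y) := by
      funext b
      by_cases hb : b ∈ freeBonds S T
      · rw [ιA_apply_of_mem _ hb, ιA_apply_of_mem _ hb, LinearIsometryEquiv.piLpCongrRight_apply]
        rfl
      · rw [ιA_apply_of_not_mem _ hb, ιA_apply_of_not_mem _ hb, map_zero]
    rw [sliceFn_apply, sliceFn_apply, expMul_gaugeAct_eq_gaugeAct_expMul_ad, hf u, hι]

/-- ★★ **AT THE BACKGROUND OF RECORD, EVERY GAUGE**: for `f = fun177std (bgMSCoPOfRecord F 2 ν Kt k′ Ω) M₁ Z k`, `k ≤ m + K`, and every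
`u`, the slice function at `W^u` is the slice function at `W` precomposed with the bondwise rotation `R` — unconditionally
(`B15Eq177ValueInvarianceCoDiv.fun177std_bgMSCoPOfRecord_gaugeAct`). [cite: Balaban1989LargeFieldI, (1.77) and the sentence after it, p.194] -/
theorem exists_adSlice_sliceFn_fun177std_bgMSCoPOfRecord_gaugeAct {F : T4Family} (ν : Stage7Numerics) (Kt k' : ℕ)
    (Ω : ℕ → Set (Site (F.P Kt) 0)) (M₁ : ℕ) (Z : Set (Site (F.P Kt) 0)) {k : ℕ} (hk : k ≤ (F.P Kt).m + (F.P Kt).K)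
    (S : Set (Site (F.P Kt) k)) (T : Finset (PBond (F.P Kt) k)) (u : GaugeTransf (F.P Kt) k SU2) (W : GaugeField (F.P Kt) k SU2) :
    ∃ R : GaugeSlice S T E3 ≃ₗᵢ[ℝ] GaugeSlice S T E3,
      (∀ (Y : GaugeSlice S T E3) (b : ↥(freeBonds S T)), R Y b = adSU2 (u b.1.src)⁻¹ (Y b)) ∧
      ∀ Y : GaugeSlice S T E3,
        sliceFn S T (fun177std (bgMSCoPOfRecord F 2 ν Kt k' Ω) M₁ Z k) (GaugeField.gaugeAct u W) Y
          = sliceFn S T (fun177std (bgMSCoPOfRecord F 2 ν Kt k' Ω) M₁ Z k) W (R Y) :=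
  exists_adSlice_sliceFn_gaugeAct S T (fun u' V => fun177std_bgMSCoPOfRecord_gaugeAct ν Kt k' Ω M₁ Z hk u' V) u W

end AdTransport

/-! ## §7  (v1.1) The shell-faces edition: `u = 1` on the whole big box, and the composite normaliser of the SHELL-GAUGED base field -/

section BigBox

variable {P : Params} {j : ℕ} {G : Type*} [GaugeGroup G]

/-- The wandering bound of §1 with `W` only `ε₁`-NEAR `1` inside `[lo, hi]` (instead of `= 1`): `dist1 (a(lo)⁻¹ a(x)) ≤ |x − lo|₁·(η + ε₁)`.
[folklore] -/
private theorem dist1_wander_le_near {LO HI lo hi : Fin P.d → ℤ} (hLO : LO ≤ lo) (hHI : hi ≤ HI)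
    {W : GaugeField P j G} {a : GaugeTransf P j G} {η ε₁ : ℝ} (hη : 0 ≤ η) (hε₁ : 0 ≤ ε₁)
    (hflat : ∀ (x : Fin P.d → ℤ) (μ : Fin P.d), LO ≤ x → x + e μ ≤ HI →
      dist1 (GaugeField.gaugeAct a W ⟨castSite x, μ⟩) ≤ η)
    (h1 : ∀ (x : Fin P.d → ℤ) (μ : Fin P.d), lo ≤ x → x + e μ ≤ hi → dist1 (W ⟨castSite x, μ⟩) ≤ ε₁) :
    ∀ (m : ℕ) (x : Fin P.d → ℤ), lo ≤ x → x ≤ hi → (∑ κ, (x κ - lo κ)) ≤ m →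
      dist1 ((a (castSite lo))⁻¹ * a (castSite x)) ≤ m * (η + ε₁) := by
  intro m
  induction m with
  | zero =>
    intro x hx hx' hsum
    have hnn : ∀ κ ∈ (Finset.univ : Finset (Fin P.d)), 0 ≤ x κ - lo κ := fun κ _ => by linarith [hx κ]
    have h0 : ∑ κ, (x κ - lo κ) = 0 := le_antisymm (by exact_mod_cast hsum) (Finset.sum_nonneg hnn)
    have hx0 : x = lo := by
      funext κ
      have := (Finset.sum_eq_zero_iff_of_nonneg hnn).1 h0 κ (Finset.mem_univ _)
      linarith
    subst hx0
    simp [GaugeGroup.dist1_one]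
  | succ m ih =>
    intro x hx hx' hsum
    by_cases hxlo : x = lo
    · subst hxlo
      rw [inv_mul_cancel, GaugeGroup.dist1_one]
      positivity
    obtain ⟨κ, hκ⟩ : ∃ κ, lo κ < x κ := by
      by_contra hne
      push Not at hne
      exact hxlo (funext fun κ => le_antisymm (hne κ) (hx κ))
    set x' : Fin P.d → ℤ := x - e κ with hx'def
    have hx'x : x' + e κ = x := by rw [hx'def]; abel
    have hlox' : lo ≤ x' := fun ι => by
      rw [hx'def, Pi.sub_apply, e_apply]
      split_ifs with h
      · subst h; linarith
      · linarith [hx ι]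
    have hx'hi : x' ≤ hi := fun ι => by
      rw [hx'def, Pi.sub_apply, e_apply]
      split_ifs <;> linarith [hx' ι]
    have hsum' : ∑ ι, (x' ι - lo ι) ≤ (m : ℤ) := by
      have e1 : ∑ ι, (x' ι - lo ι) = ∑ ι, (x ι - lo ι) - ∑ ι, e κ ι := by
        rw [← Finset.sum_sub_distrib]
        refine Finset.sum_congr rfl fun ι _ => ?_
        rw [hx'def, Pi.sub_apply]; ring
      rw [e1, sum_e]
      push_cast at hsum
      linarith
    have hih := ih x' hlox' hx'hi hsum'
    have hb := hflat x' κ (hLO.trans hlox') (by rw [hx'x]; exact hx'.trans hHI)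
    have hW1 := h1 x' κ hlox' (by rw [hx'x]; exact hx')
    have htgt : (PBond.tgt ⟨castSite x', κ⟩ : Site P j) = castSite x := by
      rw [← hx'x, castSite_add_e]; rfl
    -- `a(x′) a(x)⁻¹ = [a(x′) W a(x)⁻¹] · [a(x) W⁻¹ a(x)⁻¹]`
    have hb' : dist1 ((a (castSite x'))⁻¹ * a (castSite x)) ≤ η + ε₁ := by
      have e2 : GaugeField.gaugeAct a W ⟨castSite x', κ⟩ = a (castSite x') * W ⟨castSite x', κ⟩ * (a (castSite x))⁻¹ := by
        rw [GaugeField.gaugeAct, htgt]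
      rw [e2] at hb
      have e3 : a (castSite x') * (a (castSite x))⁻¹
          = (a (castSite x') * W ⟨castSite x', κ⟩ * (a (castSite x))⁻¹)
            * (a (castSite x) * (W ⟨castSite x', κ⟩)⁻¹ * (a (castSite x))⁻¹) := by group
      rw [dist1_inv_mul_eq_dist1_mul_inv, e3]
      refine (GaugeGroup.dist1_mul_le _ _).trans (add_le_add hb ?_)
      rw [GaugeGroup.dist1_conj, GaugeGroup.dist1_inv]
      exact hW1
    calc dist1 ((a (castSite lo))⁻¹ * a (castSite x))
        ≤ dist1 ((a (castSite lo))⁻¹ * a (castSite x')) + dist1 ((a (castSite x'))⁻¹ * a (castSite x)) :=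
          dist1_inv_mul_triangle _ _ _
      _ ≤ m * (η + ε₁) + (η + ε₁) := add_le_add hih hb'
      _ = (m + 1 : ℕ) * (η + ε₁) := by push_cast; ring

/-- ★★ **THE NORMALISING GAUGE, SHELL-FACES EDITION** (any `GaugeGroup`, level `j`): as `exists_gauge_one_on_box_nearFlat`, but the
configuration `W` is only assumed `ε₁`-NEAR `1` (`dist1 (W b) ≤ ε₁`) on the bonds inside the inner parallelepiped `Λ⁺ = castSite '' [lo, hi]`
— so that `Λ⁺` may be taken to be the WHOLE BIG BOX of p. 193 (Λ^{(k)} with its shell), which contains the source of EVERY free bond of the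
slice.  Conclusion: ∃ `u`, `u = 1` ON `Λ⁺` and `dist1 (W^u(b)) ≤ (d·n + 1)·((d − 1)nε + ε₁)` on every bond of the region `[LO, HI] ⊇ Λ⁺`.
[cite: Balaban1989LargeFieldI, p.194 (sentence after (1.77)), p.193] -/
theorem exists_gauge_one_on_bigBox_nearFlat {LO HI lo hi : Fin P.d → ℤ} (hLO : LO ≤ lo) (hHI : hi ≤ HI)
    {n : ℕ} (hn : ∀ κ, HI κ ≤ LO κ + n) (hnN : n < P.sitesPerDir j)
    {W : GaugeField P j G} {S₀ : Set (Plaq P j)} {ε ε₁ : ℝ} (hε : 0 ≤ ε) (hε₁ : 0 ≤ ε₁)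
    (hS₀ : boxPlaqs LO HI ⊆ S₀) (hW : PlaqSmallOn S₀ ε W)
    (h1 : ∀ b : PBond P j, b.src ∈ (castSite '' Set.Icc lo hi : Set (Site P j)) →
      b.tgt ∈ (castSite '' Set.Icc lo hi : Set (Site P j)) → dist1 (W b) ≤ ε₁) :
    ∃ u : GaugeTransf P j G, (∀ s ∈ (castSite '' Set.Icc lo hi : Set (Site P j)), u s = 1) ∧
      ∀ b ∈ boxBonds LO HI, dist1 (GaugeField.gaugeAct u W b)
        ≤ ((P.d : ℝ) * n + 1) * (((P.d - 1 : ℕ) : ℝ) * n * ε + ε₁) := by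
  classical
  set Λs : Set (Site P j) := castSite '' Set.Icc lo hi with hΛs
  set a : GaugeTransf P j G := axialGauge W LO HI with ha
  set η : ℝ := ((P.d - 1 : ℕ) : ℝ) * n * ε with hη
  have hη0 : 0 ≤ η := by positivity
  have hle_add_e : ∀ (x : Fin P.d → ℤ) (μ : Fin P.d), x ≤ x + e μ := fun x μ ι => by
    rw [Pi.add_apply, e_apply]; split_ifs <;> linarith
  have hflat : ∀ (x : Fin P.d → ℤ) (μ : Fin P.d), LO ≤ x → x + e μ ≤ HI →
      dist1 (GaugeField.gaugeAct a W ⟨castSite x, μ⟩) ≤ η := fun x μ hx hxμ =>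
    dist1_gaugeAct_axialGauge_le_uniform W hS₀ hW hε hn hnN hx hxμ
  have h1' : ∀ (x : Fin P.d → ℤ) (μ : Fin P.d), lo ≤ x → x + e μ ≤ hi → dist1 (W ⟨castSite x, μ⟩) ≤ ε₁ := fun x μ hx hxμ =>
    h1 _ ⟨x, ⟨hx, (hle_add_e x μ).trans hxμ⟩, rfl⟩ ⟨x + e μ, ⟨hx.trans (hle_add_e x μ), hxμ⟩, by
      rw [castSite_add_e]; rfl⟩
  have hwander : ∀ s ∈ Λs, dist1 ((a (castSite lo))⁻¹ * a s) ≤ (P.d : ℝ) * n * (η + ε₁) := by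
    rintro s ⟨x, ⟨hx, hx'⟩, rfl⟩
    have hsum : ∑ κ, (x κ - lo κ) ≤ ((P.d * n : ℕ) : ℤ) := by
      have hterm : ∀ κ ∈ (Finset.univ : Finset (Fin P.d)), x κ - lo κ ≤ (n : ℤ) := fun κ _ => by
        linarith [hx' κ, hHI κ, hLO κ, hn κ]
      calc ∑ κ, (x κ - lo κ) ≤ ∑ _κ : Fin P.d, (n : ℤ) := Finset.sum_le_sum hterm
        _ = ((P.d * n : ℕ) : ℤ) := by simp
    have h := dist1_wander_le_near hLO hHI hη0 hε₁ hflat h1' (P.d * n) x hx hx' hsum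
    push_cast at h
    exact h
  refine ⟨fun s => if s ∈ Λs then 1 else (a (castSite lo))⁻¹ * a s, fun s hs => if_pos hs, ?_⟩
  rintro b ⟨x, hx, hxμ, hsrc⟩
  obtain ⟨src, μ⟩ := b
  simp only at hsrc hxμ
  subst hsrc
  have htgt : (PBond.tgt ⟨castSite x, μ⟩ : Site P j) = castSite (x + e μ) := by
    rw [castSite_add_e]; rfl
  have hg : dist1 (a (castSite x) * W ⟨castSite x, μ⟩ * (a (castSite (x + e μ)))⁻¹) ≤ η := by
    have h := hflat x μ hx hxμ
    rwa [GaugeField.gaugeAct, htgt] at h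
  have hbound : η + (P.d : ℝ) * n * (η + ε₁) ≤ ((P.d : ℝ) * n + 1) * (η + ε₁) := by
    have : (0 : ℝ) ≤ ε₁ := hε₁
    nlinarith
  have hηle : η ≤ ((P.d : ℝ) * n + 1) * (η + ε₁) := by
    have : (0 : ℝ) ≤ (P.d : ℝ) * n * (η + ε₁) := by positivity
    nlinarith
  have hε₁le : ε₁ ≤ ((P.d : ℝ) * n + 1) * (η + ε₁) := by
    have : (0 : ℝ) ≤ (P.d : ℝ) * n * (η + ε₁) := by positivity
    nlinarith
  show dist1 ((if castSite x ∈ Λs then 1 else (a (castSite lo))⁻¹ * a (castSite x)) * W ⟨castSite x, μ⟩ *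
    ((if (PBond.tgt ⟨castSite x, μ⟩ : Site P j) ∈ Λs then 1 else (a (castSite lo))⁻¹ * a (PBond.tgt ⟨castSite x, μ⟩)))⁻¹) ≤ _
  rw [htgt]
  by_cases hs : (castSite x : Site P j) ∈ Λs <;> by_cases ht : (castSite (x + e μ) : Site P j) ∈ Λs
  · rw [if_pos hs, if_pos ht, one_mul, inv_one, mul_one]
    exact (h1 ⟨castSite x, μ⟩ hs (by rw [htgt]; exact ht)).trans hε₁le
  · rw [if_pos hs, if_neg ht]
    exact (dist1_pattern_src _ _ _ _ hg (hwander _ hs)).trans hbound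
  · rw [if_neg hs, if_pos ht]
    exact (dist1_pattern_tgt _ _ _ _ hg (hwander _ ht)).trans hbound
  · rw [if_neg hs, if_neg ht, dist1_pattern_both]
    exact hg.trans hηle

end BigBox

section ShellGauged

variable {P : Params} {k : ℕ} {G : Type*} [GaugeGroup G] {lo hi : Fin P.d → ℤ}

open B15ShellGauge193 (shellFn shellGauge_castSite pathWord vUp vLo shellSites mem_box_or_shell castSite_not_mem_boxSites_of_frozen Frozen)
open B15ShellGauge193Local (dist1_gaugeAct_shellGauge_le_local mem_outPlaqs_iff_not_mem_plaqsOf)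
open B15Extension193 (boxSites outBonds outPlaqs cutoff primed primed_of_touches primed_of_mem_outBonds gaugeAct_cutoff_extend)
open B8Lemma1NonAbelian (tw tw_nil)
open B7Prop1Explicit (seg seg_natCast hol_nil)
open T4ReTrLipUnitary (plaqSmallOn_gaugeAct_iff)

omit [GaugeGroup G] in
/-- `boxSites lo hi = castSite '' [lo, hi]` (r12's parallelepiped vs the carrier's `hbox` convention). [folklore] -/
private theorem boxSites_eq_image' (lo hi : Fin P.d → ℤ) : (boxSites lo hi : Set (Site P k)) = castSite '' Set.Icc lo hi := by
  ext y
  simp only [boxSites, Set.mem_setOf_eq, Set.mem_image, Set.mem_Icc]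
  constructor
  · rintro ⟨x, h1, h2, h3⟩; exact ⟨x, ⟨h1, h2⟩, h3⟩
  · rintro ⟨x, ⟨h1, h2⟩, h3⟩; exact ⟨x, h1, h2, h3⟩

omit [GaugeGroup G] in
/-- The multi-segment word of the zero vector is empty. [folklore] -/
private theorem tw_zero_vec {d : ℕ} (ks : List (Fin d)) : tw ks (0 : Fin d → ℤ) = [] := by
  induction ks with
  | nil => rfl
  | cons κ ks ih =>
    unfold tw at ih ⊢
    rw [List.flatMap_cons, ih, List.append_nil]
    exact seg_natCast κ 0

/-- **THE SHELL GAUGE IS `1` AT THE CORNER `c₀ = castSite (lo − 1)`** (the shell path of the corner is the empty word). [cite: Balaban1989LargeFieldI, p.193] -/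
theorem shellGauge_corner_eq_one (hlohi : lo ≤ hi) (hN : ∀ κ, hi κ - lo κ + 3 < (P.sitesPerDir k : ℤ)) (V : GaugeField P k G) :
    shellGauge V lo hi (castSite (lo - 1)) = 1 := by
  have hhi : lo - 1 ≤ hi + 1 := fun κ => by
    have := hlohi κ; rw [Pi.sub_apply, Pi.add_apply, Pi.one_apply]; linarith
  rw [shellGauge_castSite V hN le_rfl hhi]
  unfold shellFn pathWord
  have hUp : vUp lo hi (lo - 1) = 0 := by
    funext κ
    have := hlohi κ
    simp only [vUp, Pi.sub_apply, Pi.one_apply, Pi.zero_apply]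
    rw [if_neg (by linarith)]
  have hLo : vLo lo hi (lo - 1) = 0 := by
    funext κ
    have := hlohi κ
    simp only [vLo, Pi.sub_apply, Pi.one_apply, Pi.zero_apply]
    rw [if_neg (by linarith)]; ring
  rw [hUp, hLo, tw_zero_vec, List.append_nil, hol_nil]

/-- Composition of gauge transformations acts by composition: `W^{u·c} = (W^c)^u`. [cite: Balaban1985Averaging, (8) p.19] -/
theorem gaugeAct_mul_eq (u c : GaugeTransf P k G) (W : GaugeField P k G) :
    GaugeField.gaugeAct (fun s => u s * c s) W = GaugeField.gaugeAct u (GaugeField.gaugeAct c W) := by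
  funext b
  simp only [GaugeField.gaugeAct]
  group

/-- **THE SHELL-GAUGED EXTENDED DATUM IS NEAR `1` ON THE WHOLE BIG BOX**: `(cutoff Λ g) • Ṽ = primed Λ g V` (r12's
`gaugeAct_cutoff_extend`) is `1` on every bond meeting `Λ^{(k)}` and `g • V` on the shell bonds, hence — under the LOCAL (1.74) guard,
`d ≥ 3` — `dist1 ≤ 3d(n + 2)²ε` on EVERY bond of the big box `[lo − 1, hi + 1]` (`B15ShellGauge193Local.dist1_gaugeAct_shellGauge_le_local` on the
shell bonds).  Print: *«V_k↾_{∂⁺Λ} is transformed into a small configuration V′_k, |V′_k(b′) − 1| < O(1)M²ε for b′ ⊂ ∂⁺Λ. We extend it putting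
V′_k(b′) = 1 for b′∈Λ»*. [cite: Balaban1989LargeFieldI, p.193] -/
theorem dist1_primed_shellGauge_le_bigBox (hd : 3 ≤ P.d) (hlohi : lo ≤ hi) {n : ℕ} (hn : ∀ κ, hi κ ≤ lo κ + n)
    (hN : ∀ κ, hi κ - lo κ + 3 < (P.sitesPerDir k : ℤ)) {Z Λ : Set (Site P 0)}
    (hbox : pts k Λ = (castSite '' Set.Icc lo hi : Set (Site P k)))
    (hZ : (boxPlaqs (lo - 1) (hi + 1) : Set (Plaq P k)) ⊆ plaqsInside (pts k Z))
    {ε : ℝ} (hε : 0 ≤ ε) {V : GaugeField P k G} (hreg : PlaqSmallOn (plaqsInside (pts k (Z ∩ Λᶜ))) ε V) :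
    ∀ b ∈ boxBonds (lo - 1) (hi + 1),
      dist1 (GaugeField.gaugeAct (cutoff (pts k Λ) (shellGauge V lo hi)) (extend (pts k Λ) (shellGauge V lo hi) V) b)
        ≤ 3 * P.d * (n + 2) ^ 2 * ε := by
  have hΛ : pts k Λ = boxSites lo hi := hbox.trans (boxSites_eq_image' lo hi).symm
  have hS₀ : ∀ p ∈ (boxPlaqs (lo - 1) (hi + 1) : Set (Plaq P k)), p ∈ outPlaqs (boxSites (k := k) lo hi) →
      p ∈ plaqsInside (pts k (Z ∩ Λᶜ)) := by
    intro p hp hp'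
    rw [pts_inter_compl, mem_plaqsInside_inter_iff, mem_plaqsInside_compl_iff, hΛ]
    exact ⟨hZ hp, (mem_outPlaqs_iff_not_mem_plaqsOf _ p).1 hp'⟩
  have hpos : (0 : ℝ) ≤ 3 * P.d * (n + 2) ^ 2 * ε := by positivity
  rintro b ⟨x, hx, hxμ, hsrc⟩
  rw [gaugeAct_cutoff_extend]
  by_cases hb : Touches (pts k Λ) b
  · rw [primed_of_touches _ _ hb, GaugeGroup.dist1_one]
    exact hpos
  · have hout : b ∈ outBonds (pts k Λ) := (B15Extension193.mem_outBonds_iff_not_touches b).2 hb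
    rw [primed_of_mem_outBonds _ _ hout]
    rw [hΛ] at hout
    obtain ⟨src, μ⟩ := b
    simp only at hsrc hxμ
    subst hsrc
    have hx' : x ≤ hi + 1 := fun κ => by
      have h1 := hxμ κ; have h2 : (0 : ℤ) ≤ e μ κ := by rw [e_apply]; split_ifs <;> simp
      rw [Pi.add_apply] at h1; linarith
    have hlo' : lo - 1 ≤ x + e μ := fun κ => by
      have h1 := hx κ; have h2 : (0 : ℤ) ≤ e μ κ := by rw [e_apply]; split_ifs <;> simp
      rw [Pi.add_apply]; linarith
    have hs : (castSite x : Site P k) ∈ shellSites lo hi :=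
      (mem_box_or_shell hx hx').resolve_left hout.1
    have ht : (castSite (x + e μ) : Site P k) ∈ shellSites lo hi := by
      have h := (mem_box_or_shell (k := k) hlo' hxμ).resolve_left
      refine h ?_
      have : (PBond.tgt ⟨castSite x, μ⟩ : Site P k) = castSite (x + e μ) := by rw [castSite_add_e]; rfl
      rw [← this]; exact hout.2
    have ht' : (PBond.tgt ⟨castSite x, μ⟩ : Site P k) ∈ shellSites lo hi := by
      rw [show (PBond.tgt ⟨castSite x, μ⟩ : Site P k) = castSite (x + e μ) by rw [castSite_add_e]; rfl]; exact ht
    exact dist1_gaugeAct_shellGauge_le_local hd hlohi hn hN hε hS₀ hreg hs ht'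

/-- ★★★ **THE COMPOSITE NORMALISER OF THE SHELL-GAUGED BASE FIELD** (any `GaugeGroup`, `d ≥ 3`; the objects of Proposition 1 as in
`exists_gauge_normalising_extend`, with the region parallelepiped `[LO, HI]` now containing the BIG box `[lo − 1, hi + 1]`).  For every base field
`V_k` in the (1.74) guard there are gauge transformations `u′`, `ũ` of `T^{(k)}` with
(i) `u′ = 1` ON THE WHOLE BIG BOX `castSite '' [lo − 1, hi + 1]` — which contains the source of every bond meeting `Λ^{(k)}`, i.e. of every free
bond of any slice `(pts k Λ, T)`;
(ii) `ũ = u′ · cutoff Λ^{(k)} g` pointwise, `g = shellGauge V_k lo hi` — so `ũ = 1` on `Λ^{(k)}`, `ũ = g` on the shell, and `ũ(c₀) = 1`;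
(iii) the extension follows: `Ṽ(V_k^{ũ}) = Ṽ(V_k)^{ũ}` (§5);
(iv) `Ṽ(V_k)^{ũ} = (Ṽ(V_k)^{cutoff g})^{u′}` is near `1` on EVERY bond of the region box:
`dist1 ≤ (d·n′ + 1)·((d − 1)n′·(12d(n + 2)² + 1)ε + 3d(n + 2)²ε)`.
So the shell-gauged base field `V_k′ := V_k^{cutoff g}` (in the guard again, `plaqSmallOn_gaugeAct_iff`) has an extended datum normalised by a
gauge that is `1` at the source of every free bond (§3 applies to it verbatim), while `V_k ↦ V_k′` itself moves the slice coordinates on the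
incoming free bonds by `Ad(g(b₋)⁻¹)` (§6) — the located cost of p. 194's orbit remark for the comb tree of record. [cite: Balaban1989LargeFieldI, p.193, p.194 (sentence after (1.77))] -/
theorem exists_gauge_normalising_extend_shellGauged (hd : 3 ≤ P.d) (hlohi : lo ≤ hi) {n : ℕ}
    (hn : ∀ κ, hi κ ≤ lo κ + n) (hN : ∀ κ, hi κ - lo κ + 3 < (P.sitesPerDir k : ℤ)) {Z Λ : Set (Site P 0)}
    (hbox : pts k Λ = (castSite '' Set.Icc lo hi : Set (Site P k)))
    (hZ : (boxPlaqs (lo - 1) (hi + 1) : Set (Plaq P k)) ⊆ plaqsInside (pts k Z))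
    {LO HI : Fin P.d → ℤ} (hLO : LO ≤ lo - 1) (hHI : hi + 1 ≤ HI) {n' : ℕ} (hn' : ∀ κ, HI κ ≤ LO κ + n')
    (hn'N : n' < P.sitesPerDir k) (hR : (boxPlaqs LO HI : Set (Plaq P k)) ⊆ plaqsInside (pts k Z))
    {ε : ℝ} (hε : 0 < ε) {V : GaugeField P k G} (hreg : PlaqSmallOn (plaqsInside (pts k (Z ∩ Λᶜ))) ε V) :
    ∃ u' ũ : GaugeTransf P k G,
      (∀ s ∈ (castSite '' Set.Icc (lo - 1) (hi + 1) : Set (Site P k)), u' s = 1) ∧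
      (∀ s, ũ s = u' s * cutoff (pts k Λ) (shellGauge V lo hi) s) ∧
      (∀ s ∈ pts k Λ, ũ s = 1) ∧ ũ (castSite (lo - 1)) = 1 ∧
      extend (pts k Λ) (shellGauge (GaugeField.gaugeAct ũ V) lo hi) (GaugeField.gaugeAct ũ V)
        = GaugeField.gaugeAct ũ (extend (pts k Λ) (shellGauge V lo hi) V) ∧
      ∀ b ∈ boxBonds LO HI, dist1 (GaugeField.gaugeAct ũ (extend (pts k Λ) (shellGauge V lo hi) V) b)
        ≤ ((P.d : ℝ) * n' + 1) * (((P.d - 1 : ℕ) : ℝ) * n' * ((12 * P.d * (n + 2) ^ 2 + 1) * ε) + 3 * P.d * (n + 2) ^ 2 * ε) := by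
  set g : GaugeTransf P k G := shellGauge V lo hi with hg
  set W : GaugeField P k G := extend (pts k Λ) g V with hWdef
  set W' : GaugeField P k G := GaugeField.gaugeAct (cutoff (pts k Λ) g) W with hW'def
  -- plaquettes of `W′` in `Z^{(k)}`: those of `W` (§4), gauge invariance
  obtain ⟨hplaq, -⟩ := dist1_plaqHol_extend_shellGauge_le (G := G) hd hlohi hn hN hbox hZ hε hreg
  have hW : PlaqSmallOn (plaqsInside (pts k Z)) ((12 * P.d * (n + 2) ^ 2 + 1) * ε) W := fun p hp =>
    calc dist1 (plaqHol W p) ≤ 12 * P.d * (n + 2) ^ 2 * ε := hplaq p hp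
      _ < (12 * P.d * (n + 2) ^ 2 + 1) * ε := by nlinarith
  have hW' : PlaqSmallOn (plaqsInside (pts k Z)) ((12 * P.d * (n + 2) ^ 2 + 1) * ε) W' :=
    (plaqSmallOn_gaugeAct_iff _ _ _ W).2 hW
  -- `W′` is near `1` on the big box
  have h1 : ∀ b : PBond P k, b.src ∈ (castSite '' Set.Icc (lo - 1) (hi + 1) : Set (Site P k)) →
      b.tgt ∈ (castSite '' Set.Icc (lo - 1) (hi + 1) : Set (Site P k)) → dist1 (W' b) ≤ 3 * P.d * (n + 2) ^ 2 * ε := by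
    rintro b ⟨x, ⟨hx, hx'⟩, hsrc⟩ ⟨y, ⟨hy, hy'⟩, htgt⟩
    refine dist1_primed_shellGauge_le_bigBox hd hlohi hn hN hbox hZ hε.le hreg b ⟨x, hx, ?_, hsrc.symm⟩
    -- `x + e_dir ≤ hi + 1`: the target is `castSite y` with `y ≤ hi + 1`, and `castSite` is injective on the big box
    have htgt' : (castSite y : Site P k) = castSite (x + e b.dir) := by
      rw [htgt, castSite_add_e, hsrc]; rfl
    have e1 : ∀ κ, lo κ - 1 ≤ y κ := fun κ => by have h := hy κ; rwa [Pi.sub_apply, Pi.one_apply] at h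
    have e2 : ∀ κ, y κ ≤ hi κ + 2 := fun κ => by
      have h : y κ ≤ (hi + 1) κ := hy' κ
      rw [Pi.add_apply, Pi.one_apply] at h; linarith
    have e3 : ∀ κ, lo κ - 1 ≤ (x + e b.dir) κ := fun κ => by
      have h : (lo - 1) κ ≤ x κ := hx κ
      rw [Pi.sub_apply, Pi.one_apply] at h
      have h0 : (0 : ℤ) ≤ e b.dir κ := by rw [e_apply]; split_ifs <;> simp
      rw [Pi.add_apply]; linarith
    have e4 : ∀ κ, (x + e b.dir) κ ≤ hi κ + 2 := fun κ => by
      have h : x κ ≤ (hi + 1) κ := hx' κ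
      rw [Pi.add_apply, Pi.one_apply] at h
      have h0 : e b.dir κ ≤ (1 : ℤ) := by rw [e_apply]; split_ifs <;> simp
      rw [Pi.add_apply]; linarith
    have heq : y = x + e b.dir := B15Extension193.castSite_inj_big hN e1 e2 e3 e4 htgt'
    rw [← heq]; exact hy'
  have hε' : (0 : ℝ) ≤ (12 * P.d * (n + 2) ^ 2 + 1) * ε := by positivity
  have hε₁ : (0 : ℝ) ≤ 3 * P.d * (n + 2) ^ 2 * ε := by positivity
  obtain ⟨u', hu'1, hu'⟩ := exists_gauge_one_on_bigBox_nearFlat hLO hHI hn' hn'N hε' hε₁ hR hW' h1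
  -- the corner and `Λ^{(k)}` lie in the big box
  have hlobig : ∀ x : Fin P.d → ℤ, lo ≤ x → x ≤ hi → (castSite x : Site P k) ∈ (castSite '' Set.Icc (lo - 1) (hi + 1) : Set (Site P k)) :=
    fun x hx hx' => ⟨x, ⟨fun κ => by have := hx κ; rw [Pi.sub_apply, Pi.one_apply]; linarith,
      fun κ => by have := hx' κ; rw [Pi.add_apply, Pi.one_apply]; linarith⟩, rfl⟩
  have hc₀big : (castSite (lo - 1) : Site P k) ∈ (castSite '' Set.Icc (lo - 1) (hi + 1) : Set (Site P k)) :=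
    ⟨lo - 1, ⟨le_rfl, fun κ => by have := hlohi κ; rw [Pi.sub_apply, Pi.add_apply, Pi.one_apply]; linarith⟩, rfl⟩
  have hd0 : 0 < P.d := by omega
  have hc₀Λ : (castSite (lo - 1) : Site P k) ∉ pts k Λ := by
    rw [hbox, ← boxSites_eq_image']
    exact castSite_not_mem_boxSites_of_frozen hlohi hN (κ₀ := ⟨0, hd0⟩) (Or.inl (by rw [Pi.sub_apply, Pi.one_apply]))
  refine ⟨u', fun s => u' s * cutoff (pts k Λ) g s, hu'1, fun s => rfl, fun s hs => ?_, ?_, ?_, fun b hb => ?_⟩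
  · -- `ũ = 1` on `Λ^{(k)}`
    have hs' : s ∈ (castSite '' Set.Icc (lo - 1) (hi + 1) : Set (Site P k)) := by
      have hs2 := hs
      rw [hbox] at hs2; obtain ⟨x, ⟨hx, hx'⟩, rfl⟩ := hs2; exact hlobig x hx hx'
    show u' s * cutoff (pts k Λ) g s = 1
    rw [hu'1 s hs', cutoff_of_mem g hs, one_mul]
  · -- `ũ(c₀) = 1`
    show u' (castSite (lo - 1)) * cutoff (pts k Λ) g (castSite (lo - 1)) = 1
    rw [hu'1 _ hc₀big, cutoff_of_not_mem g hc₀Λ, one_mul, hg, shellGauge_corner_eq_one hlohi hN V]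
  · -- the extension follows `ũ` (§5)
    have hu1 : ∀ s ∈ (castSite '' Set.Icc lo hi : Set (Site P k)), u' s * cutoff (pts k Λ) g s = 1 := by
      intro s hs
      have hsΛ : s ∈ pts k Λ := by rw [hbox]; exact hs
      obtain ⟨x, ⟨hx, hx'⟩, rfl⟩ := hs
      rw [hu'1 _ (hlobig x hx hx'), cutoff_of_mem g hsΛ, one_mul]
    have hu0 : u' (castSite (lo - 1)) * cutoff (pts k Λ) g (castSite (lo - 1)) = 1 := by
      rw [hu'1 _ hc₀big, cutoff_of_not_mem g hc₀Λ, one_mul, hg, shellGauge_corner_eq_one hlohi hN V]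
    have h := extend_gaugeAct_of_eq_one (lo := lo) (hi := hi) hN (fun s => u' s * cutoff (pts k Λ) g s) V
      (by rw [← hbox]; exact fun s hs => hu1 s (by rw [← hbox]; exact hs)) hu0
    rw [← hbox] at h
    exact h
  · -- near-flatness on the region box
    rw [gaugeAct_mul_eq]
    exact hu' b hb

end ShellGauged

/-! ## §8  (v1.1) The positivity letter (1.9) is a statement about the gauge ORBIT: transport of the slice Hessian form along the rotation -/

section HessianTransport

variable {P : Params} {k : ℕ}

open B15Prop1SliceTaylorCalculus (rGrad rieszR inner_rieszR)

/-- **THE COORDINATE GRADIENT OF A FUNCTION PRECOMPOSED WITH A LINEAR ISOMETRY**: `∇(g ∘ R)(Y) = R⁻¹ ∇g(RY)` on the slice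
(`⟨δ, ∇(g∘R)(Y)⟩ = Dg(RY)(Rδ) = ⟨Rδ, ∇g(RY)⟩ = ⟨δ, R⁻¹∇g(RY)⟩`; `ContinuousLinearEquiv.comp_right_fderiv`, no differentiability hypothesis).
[cite: Balaban1989LargeFieldII, (1.12) p.359] -/
theorem rGrad_comp_linearIsometryEquiv (S : Set (Site P k)) (T : Finset (PBond P k)) (g : GaugeSlice S T E3 → ℝ)
    (R : GaugeSlice S T E3 ≃ₗᵢ[ℝ] GaugeSlice S T E3) (Y : GaugeSlice S T E3) :
    rGrad S T (g ∘ R) Y = R.symm (rGrad S T g (R Y)) := by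
  apply ext_inner_left ℝ
  intro δ
  unfold rGrad
  rw [inner_rieszR]
  have h1 : fderiv ℝ (g ∘ R) Y = (fderiv ℝ g (R Y)).comp (R.toContinuousLinearEquiv : GaugeSlice S T E3 →L[ℝ] GaugeSlice S T E3) :=
    R.toContinuousLinearEquiv.comp_right_fderiv
  rw [h1, ContinuousLinearMap.comp_apply]
  have h2 : inner ℝ δ (R.symm (rieszR S T (fderiv ℝ g (R Y))))
      = inner ℝ (R δ) (R (R.symm (rieszR S T (fderiv ℝ g (R Y))))) :=
    (R.inner_map_map _ _).symm
  rw [h2, LinearIsometryEquiv.apply_symm_apply, inner_rieszR]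
  rfl

/-- **THE SLICE HESSIAN FORM TRANSPORTS ALONG A LINEAR ISOMETRY**: `⟨X, D(∇(g∘R))(0)X⟩ = ⟨RX, D(∇g)(0)(RX)⟩` (chain rule at `R0 = 0` on both
sides of `∇(g∘R) = R⁻¹ ∘ ∇g ∘ R`, unconditionally in `fderiv`'s conventions). [cite: Balaban1989LargeFieldII, (1.9) p.358, (1.12) p.359] -/
theorem inner_fderiv_rGrad_comp_linearIsometryEquiv (S : Set (Site P k)) (T : Finset (PBond P k)) (g : GaugeSlice S T E3 → ℝ)
    (R : GaugeSlice S T E3 ≃ₗᵢ[ℝ] GaugeSlice S T E3) (X : GaugeSlice S T E3) :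
    inner ℝ X (fderiv ℝ (rGrad S T (g ∘ R)) 0 X) = inner ℝ (R X) (fderiv ℝ (rGrad S T g) 0 (R X)) := by
  have hfun : rGrad S T (g ∘ R) = R.symm.toContinuousLinearEquiv ∘ (rGrad S T g ∘ R.toContinuousLinearEquiv) := by
    funext Y
    exact rGrad_comp_linearIsometryEquiv S T g R Y
  rw [hfun, ContinuousLinearEquiv.comp_fderiv, ContinuousLinearEquiv.comp_right_fderiv, ContinuousLinearMap.comp_apply,
    ContinuousLinearMap.comp_apply]
  show inner ℝ X (R.symm (fderiv ℝ (rGrad S T g) (R 0) (R X))) = _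
  rw [map_zero, ← R.inner_map_map X, LinearIsometryEquiv.apply_symm_apply]

/-- ★★ **COERCIVITY OF THE SLICE HESSIAN ((1.9) ∕ the positivity letter (m1)) IS INVARIANT UNDER LINEAR ISOMETRIES OF THE COORDINATES**: if
`γ‖X‖² ≤ ⟨X, D(∇g)(0)X⟩` for all `X`, then the same holds for `g ∘ R`. [cite: Balaban1989LargeFieldII, (1.9) p.358] -/
theorem coercive_rGrad_comp_linearIsometryEquiv (S : Set (Site P k)) (T : Finset (PBond P k)) {g : GaugeSlice S T E3 → ℝ}
    (R : GaugeSlice S T E3 ≃ₗᵢ[ℝ] GaugeSlice S T E3) {γ : ℝ}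
    (hg : ∀ X : GaugeSlice S T E3, γ * ‖X‖ ^ 2 ≤ inner ℝ X (fderiv ℝ (rGrad S T g) 0 X)) (X : GaugeSlice S T E3) :
    γ * ‖X‖ ^ 2 ≤ inner ℝ X (fderiv ℝ (rGrad S T (g ∘ R)) 0 X) := by
  rw [inner_fderiv_rGrad_comp_linearIsometryEquiv, ← R.norm_map X]
  exact hg (R X)

/-- ★★★ **THE POSITIVITY LETTER (1.9) AT THE SLICE IS A STATEMENT ABOUT THE GAUGE ORBIT OF THE DATUM**: for a gauge-invariant `f` and EVERY
gauge transformation `u` of `T^{(k)}`, the coercivity `γ‖X‖² ≤ ⟨X, D(∇ sliceFn S T f ·)(0) X⟩` holds at `W^u` iff it holds at `W` (§6's rotation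
`R` is a linear isometry of the slice; both directions by `R` and `R⁻¹`).  So p. 194's remark *«it is natural to consider it on orbits of this
group»* applies to [LF-II]'s (1.9) VERBATIM, with no compensating term — unlike the curl form of the (1.7) letter, which moves under `R`.
[cite: Balaban1989LargeFieldI, p.194 (sentence after (1.77)); Balaban1989LargeFieldII, (1.9) p.358] -/
theorem sliceCoercive_gaugeAct_iff (S : Set (Site P k)) (T : Finset (PBond P k)) {f : GaugeField P k SU2 → ℝ} (hf : GaugeInvariant f)
    (u : GaugeTransf P k SU2) (W : GaugeField P k SU2) (γ : ℝ) :
    (∀ X : GaugeSlice S T E3, γ * ‖X‖ ^ 2 ≤ inner ℝ X (fderiv ℝ (rGrad S T (sliceFn S T f (GaugeField.gaugeAct u W))) 0 X)) ↔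
      (∀ X : GaugeSlice S T E3, γ * ‖X‖ ^ 2 ≤ inner ℝ X (fderiv ℝ (rGrad S T (sliceFn S T f W)) 0 X)) := by
  obtain ⟨R, -, hR⟩ := exists_adSlice_sliceFn_gaugeAct S T hf u W
  have hcomp : sliceFn S T f (GaugeField.gaugeAct u W) = sliceFn S T f W ∘ R := funext hR
  have hcomp' : sliceFn S T f W = sliceFn S T f (GaugeField.gaugeAct u W) ∘ R.symm := by
    funext Y
    rw [Function.comp_apply, hcomp, Function.comp_apply, LinearIsometryEquiv.apply_symm_apply]
  constructor
  · intro h X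
    rw [hcomp']
    exact coercive_rGrad_comp_linearIsometryEquiv S T R.symm h X
  · intro h X
    rw [hcomp]
    exact coercive_rGrad_comp_linearIsometryEquiv S T R h X

/-- ★★ **AT THE BACKGROUND OF RECORD**: (1.9) for the slice of `fun177std (bgMSCoPOfRecord F 2 ν Kt k′ Ω) M₁ Z k` at `W^u` iff at `W`, every `u`,
`k ≤ m + K` — unconditionally. [cite: Balaban1989LargeFieldI, (1.77) and the sentence after it, p.194; Balaban1989LargeFieldII, (1.9) p.358] -/
theorem sliceCoercive_fun177std_bgMSCoPOfRecord_gaugeAct_iff {F : T4Family} (ν : Stage7Numerics) (Kt k' : ℕ)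
    (Ω : ℕ → Set (Site (F.P Kt) 0)) (M₁ : ℕ) (Z : Set (Site (F.P Kt) 0)) {k : ℕ} (hk : k ≤ (F.P Kt).m + (F.P Kt).K)
    (S : Set (Site (F.P Kt) k)) (T : Finset (PBond (F.P Kt) k)) (u : GaugeTransf (F.P Kt) k SU2) (W : GaugeField (F.P Kt) k SU2) (γ : ℝ) :
    (∀ X : GaugeSlice S T E3, γ * ‖X‖ ^ 2 ≤
        inner ℝ X (fderiv ℝ (rGrad S T (sliceFn S T (fun177std (bgMSCoPOfRecord F 2 ν Kt k' Ω) M₁ Z k) (GaugeField.gaugeAct u W))) 0 X)) ↔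
      (∀ X : GaugeSlice S T E3, γ * ‖X‖ ^ 2 ≤
        inner ℝ X (fderiv ℝ (rGrad S T (sliceFn S T (fun177std (bgMSCoPOfRecord F 2 ν Kt k' Ω) M₁ Z k) W)) 0 X)) :=
  sliceCoercive_gaugeAct_iff S T (fun u' V => fun177std_bgMSCoPOfRecord_gaugeAct ν Kt k' Ω M₁ Z hk u' V) u W γ

end HessianTransport

/-! ## §9  (v1.1) The PINNED half of the localised near-flatness: on the bonds meeting `Ω₁ᶜ` a (2.12) minimiser reads the normalised datum -/

section Pinned

variable {P : Params} {G : Type*} [GaugeGroup G]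

open B14.Eq213DetSet (Bj maxDomT Bj_zero)
open B14.Eq216Concrete (qsstarGIter0_eq)
open Literature.MathematicalPhysics.QuantumFieldTheory.BalabanImbrieJaffe1984to88.BIJ85Eq453GaugeField (qsstarGIter0)

/-- ★★ **ON THE BONDS MEETING `Ω₁(Z)ᶜ` A (2.12) MINIMISER IS AS NEAR `1` AS THE DATUM'S SHADOW** ([III] (2.2): `Γ₀ = Ω₁ᶜ`, the constraint at
scale `0` is `M⁰ = id`; (2.16)∕(1.3): `(Q_k^{s*}W)(b)` is `1` inside a `k`-block and `W⟨B^k b₋, μ(b)⟩` on a corridor bond): if `U` minimises the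
(2.12) problem for `𝐁_k(Z)` (`0 < k ≤ m + K`) with the data generated by the `k`-field `W`, and `b` meets `Ω₁(Z)ᶜ`, then `|U(b) − 1| ≤ δ` as soon as
`|W(c) − 1| ≤ δ` at the shadow bond `c = ⟨B^k b₋, μ(b)⟩` (only asked when `b` is a corridor bond; `0 ≤ δ`).  With `W = Ṽ_k^{ũ}` of §7 and `c` in
the region box this is the Γ₀-half of the lane's localised letter `hU` (dag-n12-w5's LOCATED-`hU`), inhabited. [cite: Balaban1988Convergent, (2.2) p.255, (2.12)–(2.13) pp.256–257, (2.16) p.257] -/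
theorem dist1_apply_le_of_isMinimizer_Bj_of_not_mem (av : ∀ j, Averaging P j G) (reg : Set (GaugeField P 0 G)) (M₁ : ℕ)
    (Z : Set (Site P 0)) {k : ℕ} (hk0 : 0 < k) (hk : k ≤ P.m + P.K) (W : GaugeField P k G) {U : GaugeField P 0 G}
    (hU : IsMinimizer av reg (Bj M₁ Z k) (avgFamily av (qsstarGIter0 k W)) U) {δ : ℝ} (hδ : 0 ≤ δ)
    {b : PBond P 0} (hb : b.src ∉ maxDomT M₁ Z 1 ∨ b.tgt ∉ maxDomT M₁ Z 1)
    (hW : B14.Eq22Determines.blockIter k b.tgt ≠ B14.Eq22Determines.blockIter k b.src → dist1 (W ⟨B14.Eq22Determines.blockIter k b.src, b.dir⟩) ≤ δ) :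
    dist1 (U b) ≤ δ := by
  have hmem : b ∈ bondsOf (Bj M₁ Z k 0) := by
    rw [Bj_zero hk0]
    exact hb
  have h1 : U b = qsstarGIter0 k W b := hU.2.1 0 b hmem
  rw [h1, qsstarGIter0_eq k hk W b]
  split_ifs with h
  · rw [GaugeGroup.dist1_one]; exact hδ
  · exact hW h

/-- The same for the residually gauged minimiser `U^σ` when `σ` is trivial at both ends of the bond (the `j = 0` clause of the root letter `hu`
of `B15Prop1GaugeRetractionOfGaugeSection.agreeOn_gaugeAct_of_residual`). [cite: Balaban1988Convergent, (2.2) p.255, (2.12) p.256] -/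
theorem dist1_gaugeAct_apply_le_of_isMinimizer_Bj_of_not_mem (av : ∀ j, Averaging P j G) (reg : Set (GaugeField P 0 G)) (M₁ : ℕ)
    (Z : Set (Site P 0)) {k : ℕ} (hk0 : 0 < k) (hk : k ≤ P.m + P.K) (W : GaugeField P k G) {U : GaugeField P 0 G}
    (hU : IsMinimizer av reg (Bj M₁ Z k) (avgFamily av (qsstarGIter0 k W)) U) {δ : ℝ} (hδ : 0 ≤ δ)
    (σ : GaugeTransf P 0 G) {b : PBond P 0} (hσs : σ b.src = 1) (hσt : σ b.tgt = 1)
    (hb : b.src ∉ maxDomT M₁ Z 1 ∨ b.tgt ∉ maxDomT M₁ Z 1)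
    (hW : B14.Eq22Determines.blockIter k b.tgt ≠ B14.Eq22Determines.blockIter k b.src → dist1 (W ⟨B14.Eq22Determines.blockIter k b.src, b.dir⟩) ≤ δ) :
    dist1 (GaugeField.gaugeAct σ U b) ≤ δ := by
  rw [GaugeField.gaugeAct, hσs, hσt, one_mul, inv_one, mul_one]
  exact dist1_apply_le_of_isMinimizer_Bj_of_not_mem av reg M₁ Z hk0 hk W hU hδ hb hW

/-- ★★ **WITH A SHADOW HYPOTHESIS AND A NORMALISED DATUM**: if the datum field `W` is `δ`-near `1` on a set `𝒞` of `k`-bonds (e.g. the region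
box of §7 for `W = Ṽ_k^{ũ}`) containing the shadow of every corridor bond meeting `Ω₁(Z)ᶜ` inside the neighbourhood `𝒩`, then the minimiser is
`δ`-near `1` on every bond of `𝒩` meeting `Ω₁(Z)ᶜ`. [cite: Balaban1988Convergent, (2.2) p.255, (2.12)–(2.13) pp.256–257, (2.16) p.257] -/
theorem dist1_apply_le_of_isMinimizer_Bj_of_shadow (av : ∀ j, Averaging P j G) (reg : Set (GaugeField P 0 G)) (M₁ : ℕ)
    (Z : Set (Site P 0)) {k : ℕ} (hk0 : 0 < k) (hk : k ≤ P.m + P.K) (W : GaugeField P k G) {U : GaugeField P 0 G}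
    (hU : IsMinimizer av reg (Bj M₁ Z k) (avgFamily av (qsstarGIter0 k W)) U) {δ : ℝ} (hδ : 0 ≤ δ)
    {𝒞 : Set (PBond P k)} (h𝒞 : ∀ c ∈ 𝒞, dist1 (W c) ≤ δ) {𝒩 : Set (PBond P 0)}
    (hshadow : ∀ b ∈ 𝒩, (b.src ∉ maxDomT M₁ Z 1 ∨ b.tgt ∉ maxDomT M₁ Z 1) → B14.Eq22Determines.blockIter k b.tgt ≠ B14.Eq22Determines.blockIter k b.src →
      (⟨B14.Eq22Determines.blockIter k b.src, b.dir⟩ : PBond P k) ∈ 𝒞)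
    {b : PBond P 0} (hb𝒩 : b ∈ 𝒩) (hb : b.src ∉ maxDomT M₁ Z 1 ∨ b.tgt ∉ maxDomT M₁ Z 1) :
    dist1 (U b) ≤ δ :=
  dist1_apply_le_of_isMinimizer_Bj_of_not_mem av reg M₁ Z hk0 hk W hU hδ hb fun h => h𝒞 _ (hshadow b hb𝒩 hb h)

end Pinned

end Literature.MathematicalPhysics.QuantumFieldTheory.Balaban1983to89.B15Prop1DatumGaugeNormalisation

end
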